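import Summits.NavierStokesRegularity.NavierStokesRegularity.Theses.SqueezeCycle
import Summits.NavierStokesRegularity.NavierStokesRegularity.Theorems.SqueezeCycleExtremalBiaxialitySubcriticalOfLiouville
import Literature.Analysis.FluidPDE.LerayGaugeStrainSpectrum
import Literature.Analysis.FluidPDE.HyperbolicDSSOrbit
import Mathlib.Analysis.InnerProductSpace.Laplacian
import Mathlib.Analysis.Calculus.Gradient.Basic
import Mathlib.Analysis.SpecialFunctions.SmoothTransition

/-!
# Disproof work file for crux `MustSqueeze` (stmt-NavierStokesRegularity-11610, route SqueezeCycle)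

Standing adversary (cdisprove), generation 2.  Generation 1 (v1–v5, 994 lines, item evidence
`20260815T221959Z … 20260815T225650Z-Disproof.lean`) could not be published to the tree (farm
unavailable) and its evidence copies are not readable from the gen-2 jail; this file REBUILDS its
certified content from the evidence notes and EXTENDS it.  Prose lives in docstrings only.

REVISION v12a (2026-08-16, gen 4): everything indexed below is certified (rc 0, 0 sorries,
0 warnings).  NEW in v11 (gen 4): §9 negative thresholds — below `a = 0` the sharp Miller
constant is `4/3`, not `2` (`production_le_fourThirds_middle_of_nonpos`, attained at
`(−2a, a, a)`; the constant-`2` form FAILS for every `a < 0`, `not_production_le_two_middle_of_neg`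
— the algebraic content of the lever's hypothesis `0 ≤ a`); §10 Targets (ctd.) — the lead's
abstract two-pass stub is FALSE at zero damping `0 ≤ c` (`twoPassGronwall_false_at_zero_damping`:
frozen state `Z ≡ E ≡ 1`; the quarter is sharp inside the lead's own stub); §11 LINEAR LERAY
PROFILES — the exact two-parameter family `linA μ b` (axisymmetric strain `diag(−μ,−μ,2μ)` +
swirl `b` about the axis) solves the tree's `IsLerayProfile ν (1/2)` iff `b(1 − 2μ) = 0`; its
physical field `lin μ b = lerayBackward ½ 0 (linA μ b)` is an exact ancient Navier–Stokes flow with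
H1, H2 and H6 at ANY threshold `a ≥ −μ` (arbitrarily negative), outside every `𝒦_C` (`lin_not_h4`,
`lin_not_h5`);
the column `μ = ½` carries the STATIONARY similarity vorticity `−2b e₂` (`lerayVorticity_lin`,
`column_stretching_balance`: stretching balances Leray's damping exactly, with `λ₂ = −½ < 0` and
production `+|Ω|²`), so `Z_R ≡ 4b²∫φ_R ≠ 0` forever: the lever's budget survives only through
`‖U‖_∞ ≤ C` in its flux constants (`Z_R ∼ R³` vs `E(2R)/R ∼ R²`); and
`not_mustSqueezeProfiles` — the self-similar shadow of the crux without normalisation is false at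
EVERY threshold.  §12 (v12): the LEVER `stub_signedBudget` is FALSE with its class hypotheses deleted
(`Targets.signedBudget_false_without_class`, witness the column with `a = 0`, `κ' = 0`: every other
hypothesis holds, `Z_R ≡ 4∫φ_R` is constant, `2R³|B₁| ≤ |κ|(56|B₁|+1)R²` fails for large `R`).  Module form of §11 (proposed as `….Negative.LinearLerayProfiles`):
folder `LinearLerayProfiles.lean`.  Literature refresh (gen 4; searchd / arXiv / OpenAlex degraded,
crossref + galaxy up): unchanged — no ancient / Type-I statement under strain-eigenvalue control in
print; Lemarié-Rieusset (2nd ed.) and Miller 2020 (sum spaces, arXiv:2007.02023) only forward.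

REVISION v10a (2026-08-16, gen 3, cycle 3): everything indexed below is certified (rc 0,
0 sorries, 0 warnings).  LANDED as importable modules (gate-accepted, `--supports` this item):
`Summits.NavierStokesRegularity.NavierStokesRegularity.Theorems.MustSqueeze.Negative.GaussianVortex`
(p70289: the witness `wit`, `DW`, all bounds, `Cw`), `….Negative.WithoutOseen` (p70522: clauses
`H1`–`H6`, `InClass`, `mustSqueeze_iff`, `mustSqueeze_false_without_H3`) and
`….Negative.ConstantsKNSSMild` (p71350: `isKNSSMild_const`, `mustSqueeze_false_without_H4H5`) —
ideators / planners / provers should `import` those rather than this work file.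
New in v10: §3b (the quarter is Leray's exponent — forward ODE skeleton, tightness at `a = 1/4`),
§6 (reductions: the crux holds under (L); refutation criterion), §7 (threshold family
`MustSqueezeAt a`, antitone; forward time shifts improve the squeeze), §8 (Targets: the lead's
abstract two-pass Grönwall stub — three hypotheses load-bearing with explicit witnesses, three
removable).  LANDED from v10 (gen 3, all ACCEPTED, `--supports`):
`….Negative.QuarterLerayExponent` (p72296: §3b), `….Negative.TwoPassGronwallLoadBearing`
(p72320: §8, the three `twoPassGronwall_false_without_*`), `….Negative.Reductions` (p72331:
§6–§7, `MustSqueezeAt`, `not_mustSqueeze_iff`, `not_liouvilleConjectureNS_of_not_mustSqueeze`).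
Literature refresh 2026-08-16 (crossref + OpenAlex; searchd / S2 / arXiv degraded this cycle):
2025–26 print on the middle eigenvalue is still forward criteria only (Guo–O 2025
doi:10.1016/j.aml.2024.109354, O–Wu 2026 doi:10.1002/mana.70139); new Liouville theorems are all
STEADY (Chae 2025, Chamorro–Vergara-Hermosilla 2025 doi:10.4171/dm/1018, Shen–Ma 2026); nothing on
ancient / Type-I solutions under strain-eigenvalue control — no counterexample candidate in print.

## Findings (index)

* §0 `mustSqueeze_iff` — the crux is literally `InClass C u → H6 (1/8) u → u ≡ 0 on t<0` over the
  named clauses H1–H6 below; `mustSqueeze_holds_of_nonpos` — for `C ≤ 0` the instance is trivially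
  true (H4 forces `u ≡ 0`); `inClass_zero` — the hypotheses are satisfiable (`u ≡ 0`, `C ≥ 0`), so
  the crux is not vacuous, and the zero field also satisfies the conclusion (no junk refutation).
* §1 LOAD-BEARING (normalisation): `isKNSSMild_const` — every CONSTANT field satisfies the typed
  KNSS/Oseen mild clause H3 (the written-out kernel is odd in `x - y`, so the Bochner integral
  vanishes by reflection invariance with no integrability input, and `e^{σΔ} c = c`);
  `mustSqueeze_false_without_H4H5` — the crux with the Type-I clause H4 AND the scaled-energy clause
  H5 deleted is FALSE (witness `u ≡ e₀`).  Any proof must use H4 ∨ H5.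
* §2 LOAD-BEARING (the PDE): `mustSqueeze_false_without_H3` — the crux with ONLY the mild clause H3
  deleted is FALSE: the Gaussian vortex `wit t x = (1/8)·e^{t/2}·e^{-‖x‖²}·(x₀e₁ − x₁e₀)` is smooth
  (H1), divergence free (H2), Type-I (H4), has both scale-invariant local energies bounded on every
  backward parabolic cylinder (H5), is squeezed `Λ ≤ 1/8` everywhere (H6) and is not zero.  So the
  typed side clauses hide no junk and the crux is exactly as strong as the Oseen identity.
* §3 EXACT sl(3) ALGEBRA (why the localisation is not a formality):
  `production_le_two_middle` — `−4 λ₁λ₂λ₃ ≤ 2 λ₂⁺ (λ₁²+λ₂²+λ₃²)` for ordered trace-free triples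
  (the engine's pointwise bound `−4 det S ≤ 2λ₂⁺|S|²`, Miller 2019 Lemma 5.1);
  `production_const_sharp` — the constant `2` cannot be lowered (near plane strain
  `(1, ε, −1−ε)`), so the engine's threshold `sup Λ < 1/4` is intrinsic;
  `not_pointwise_surrogate` — the POINTWISE surrogate "Λ ≤ 1/8 ⇒ ω·Sω ≤ 2·(1/8)|S|²" is false
  (an explicit trace-free gradient whose squeezed-plane form is `≤ −½|ξ|²` yet `ω·Sω = 16 > 0`,
  all of it the null-Lagrangian part `4 det A`): the cubic flux `4∫u₁(∇u₂×∇u₃)·∇φ` of any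
  localisation is leading order, not an error term.
* §4 KINEMATIC BOOKKEEPING of the two crux ideas (leaky-quarter-law, singular-rate-squeeze),
  certified as matrix identities: `vorticity_sq_eq` (`|ω|² = |A|² − tr A²`), `strain_sq_eq`
  (`|S|² = ½(|A|² + tr A²)`), hence `strain_sq_eq_half_vorticity_add_trace_sq`
  (`|S|² = ½|ω|² + tr A²`, the pointwise form of `∫|S|²φ = ½Z_φ − ∫((U·∇)U)·∇φ`);
  `radial_cutoff_drift_nonpos` — the Leray-drift flux weight `⟪y, ∇φ(y)⟫ ≤ 0` for every cutoff
  `φ = ψ ∘ ‖·‖²` with `ψ` antitone (the ONE flux of order `R` is signed, as card leaky-quarter-law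
  claims); `ancient_gronwall` — the backward-Grönwall engine of both passes of that card
  (`z' ≤ −c z + K` on `(−∞, s₀]`, `z ≤ B` at arbitrarily negative times `⇒ z s₀ ≤ K/c`),
  `exists_good_time` (good times from a unit-time-averaged bound) and their chaining
  `ancient_gronwall_of_time_average` (pass 1 of the card in abstract form).
* §3b THE QUARTER IS LERAY'S EXPONENT (forward skeleton of the engine, real-variable form):
  `forward_gauge_comparison` (`(T−t)y' ≤ 2a·y ⇒ y(T−t)^{2a}` non-increasing),
  `no_leray_rate_of_subquarter` (`a < 1/4` is incompatible with Leray's lower bound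
  `c ≤ y√(T−t)`: "squeezed below ¼ ⇒ no blow-up" is three lines for finite-enstrophy solutions),
  `quarter_rate_saturates` (`y = (T−t)^{−1/2}` realises equality at `a = 1/4`: the mechanism is
  void at the quarter from the forward side too).
* §5 WHY THE CRUX RESISTS (module docstring §5): a counterexample is a NONZERO element of
  `𝒦_C` (⇔ a Type-I singularity, Albritton–Barker 2019 Thm 1.1) with `(−t)λ₂(S) ≤ 1/8`; none is
  known; and the hand audit of card leaky-quarter-law (drift sign, Morrey translation, flux orders)
  found no error — the crux is more likely TRUE (provable by the signed-drift localisation) than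
  false.  Recorded so that provers spend their time on the localisation, not on the algebra.
* §6 REDUCTIONS (what a kill would kill): `mustSqueeze_of_squeezeLiouville`,
  `mustSqueeze_of_liouvilleConjectureNS` (the crux HOLDS under the KNSS Liouville conjecture (L),
  via the tree's `Theorems.squeezeLiouville_of_liouvilleConjectureNS`),
  `not_liouvilleConjectureNS_of_not_mustSqueeze` (a refutation of the crux refutes (L)), and the
  refutation criterion `not_mustSqueeze_iff` (∃ C > 0 and a nonzero, everywhere-squeezed member
  of `𝒦_C`, automatically a Type-I KNSS-mild field).
* §7 THRESHOLD FAMILY: `MustSqueezeAt a` (`MustSqueeze = MustSqueezeAt (1/8)`), `h6_mono`,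
  `mustSqueezeAt_antitone` (larger threshold = stronger statement; conjecturally true for every
  `a < 1/4`), `mustSqueezeAt_of_squeezeLiouville`, `h6_comp_sub` (forward time shifts
  `t ↦ u(t − δ)` preserve — indeed improve — the squeeze; the counterexample set is closed under
  them).
* §8 TARGETS (lead skeleton v1 `Lines/outward-drift-signed-flux.lean`, stub
  `stub_twoPassGronwall`, restated verbatim as `Targets.TwoPassGronwall`): the stub is FALSE with
  any one of three hypotheses deleted — `twoPassGronwall_false_without_goodTimes` (drop
  `Z R ≤ 6E(2R)`: `Z = e^{−s}`, `E = min(1, e^{−s})`), `…_without_timeAverage` (drop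
  `∫_s^{s+1}E ρ ≤ Bρ`: `Z = E = e^{−s}`), `…_without_comparison` (drop
  `E R ≤ Z R + κ'√(E(2R)/R)`: `Z ≡ 0`, `E ≡ 1`); and three hypotheses are never used by the
  two-pass argument (`0 ≤ Z`, `Z` monotone in `R`, continuity of `K` — replace `K` by its
  continuous majorant), see the docstring of `Targets.TwoPassGronwall`.
* §9 NEGATIVE THRESHOLDS: `production_le_fourThirds_middle_of_nonpos` (`λ₂ ≤ 0 ⇒ −4λ₁λ₂λ₃ ≤
  (4/3)λ₂|S|²`), `production_le_fourThirds_of_middle_le`, `production_fourThirds_attained`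
  (equality at `(−2a, a, a)`), `not_production_le_two_middle_of_neg` (the constant-`2` law is false
  for `a < 0`), `production_le_of_middle_le` (both regimes: constant `max(2a, (4/3)a)`).
* §10 TARGETS (ctd.): `Targets.twoPassGronwall_false_at_zero_damping` — `stub_twoPassGronwall` with
  `0 < c` weakened to `0 ≤ c` is FALSE (`Z ≡ E ≡ 1`, `K ≡ 0`).
* §11 LINEAR LERAY PROFILES (`section LinearProfiles`): `linA`, `linA_divFree`, `curl_linA`
  (`= −2b e₂`), `inner_linA_plane` (`−μ|ξ|²`), `isLerayProfile_linA` / `_strain` / `_column`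
  (tree `IsLerayProfile ν (1/2)`, pressure `linP = −½⟪linQ y, y⟫`, `gradient_linP`,
  `laplacian_linA`), `column_stretching_balance`, `lin_eq_lerayBackward`, `lerayOrbit_lin`
  (steady orbit), `lerayVorticity_lin` (constant `−2b e₂`), `lin_h1`, `lin_h2`, `lin_h6` (any
  `a ≥ −μ`), `lin_not_h4`, `lin_not_h5` (axial Morrey blow-up, `V1_pos`,
  `linA_ball_energy_lower`), `MustSqueezeProfiles` / `not_mustSqueezeProfiles` (false for all `a`).
* §12 TARGETS — THE LEVER: `Targets.SignedBudgetWithoutClass` (= `stub_signedBudget` minus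
  `IsTypeIAncientMild C u` and `‖U‖ ≤ C`), `Targets.signedBudget_false_without_class` (FALSE: the
  column `lin ½ 1`, `a = 0`, `κ' = 0`; cutoff lemmas `cutoff_*`, `integral_cutoff_ge`,
  `cutoffEnstrophy_col`, `frobeniusNormSq_col = 7/2`, `ballGradEnergy_col`, `cutoffGradEnergy_col`,
  `lerayMiddleStrain_col_le`); `Targets.DivCurlBallsWithoutClass` / `divCurlBalls_false_without_class`
  (the comparison stub minus class is FALSE: pure strain `lin 1 0`).
-/

noncomputable section

set_option linter.dupNamespace false

namespace Summit.NavierStokesRegularity.NavierStokesRegularity.Cruxes.MustSqueeze.Disproof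

open MeasureTheory Set Filter Topology
open Literature.Analysis.FluidPDE Literature.Analysis.UnboundedOperators
open Summit.NavierStokesRegularity.NavierStokesRegularity.Theses.SqueezeCycle

/-- Physical space `ℝ³`. -/
local notation "ℝ³" => EuclideanSpace ℝ (Fin 3)

/-! ## §0 The crux over named clauses -/

/-- H1: smoothness on `t < 0` (verbatim clause of the crux). -/
def H1 (u : ℝ → ℝ³ → ℝ³) : Prop :=
  ContDiffOn ℝ (⊤ : ℕ∞) (Function.uncurry u) (Set.Iio 0 ×ˢ Set.univ)

/-- H2: divergence free on `t < 0` (verbatim). -/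
def H2 (u : ℝ → ℝ³ → ℝ³) : Prop :=
  ∀ t < 0, Literature.Analysis.FluidPDE.VectorCalculus.IsDivFree (u t)

/-- The written-out bilinear Oseen integrand of clause H3 (verbatim). -/
def oseenIntegrand (u : ℝ → ℝ³ → ℝ³) (t τ : ℝ) (x y : ℝ³) : ℝ³ :=
  ((-(inner ℝ (x-y) (u τ y) / (2*(t-τ)) * Literature.Analysis.UnboundedOperators.heatKernel (t-τ) (x-y))) • u τ y + (∫ σ in Set.Ioi (t-τ), Literature.Analysis.UnboundedOperators.heatKernel σ (x-y) / (4*σ^2)) • (inner ℝ (x-y) (u τ y) • u τ y + inner ℝ (u τ y) (u τ y) • (x-y) + inner ℝ (x-y) (u τ y) • u τ y) - ((∫ σ in Set.Ioi (t-τ), Literature.Analysis.UnboundedOperators.heatKernel σ (x-y) / (8*σ^3)) * (inner ℝ (x-y) (u τ y) * inner ℝ (x-y) (u τ y))) • (x-y))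

/-- H3: the KNSS/Oseen mild identity between any two negative times (verbatim). -/
def H3 (u : ℝ → ℝ³ → ℝ³) : Prop :=
  ∀ s t : ℝ, s < t → t < 0 → ∀ x, u t x = Literature.Analysis.FluidPDE.heatFlow (u s) (t-s) x -
    ∫ τ in Set.Ioo s t, ∫ y, oseenIntegrand u t τ x y

/-- H4: Type-I decay in time (verbatim). -/
def H4 (C : ℝ) (u : ℝ → ℝ³ → ℝ³) : Prop :=
  Literature.Analysis.FluidPDE.HasTypeITimeDecay C u

/-- H5: scale-invariant local energies `A, E ≤ C` on every backward cylinder with top `t₀ ≤ 0`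
(verbatim). -/
def H5 (C : ℝ) (u : ℝ → ℝ³ → ℝ³) : Prop :=
  ∀ (x₀ : EuclideanSpace ℝ (Fin 3)) (t₀ r : ℝ), t₀ ≤ 0 → 0 < r → (∀ t, t₀ - r^2 < t → t < t₀ → r⁻¹ * ∫ x in Metric.ball x₀ r, ‖u t x‖^2 ≤ C) ∧ r⁻¹ * ∫ t in Set.Ioo (t₀ - r^2) t₀, ∫ x in Metric.ball x₀ r, ‖fderiv ℝ (u t) x‖^2 ≤ C

/-- H6 with threshold `a`: the Courant–Fischer form of `Λ_u(t,x) = (−t)λ₂(S) ≤ a` everywhere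
(`a = 1/8` in the crux; cf. `lerayMiddleStrain_le_iff`). -/
def H6 (a : ℝ) (u : ℝ → ℝ³ → ℝ³) : Prop :=
  ∀ t < 0, ∀ x, (∃ v w : EuclideanSpace ℝ (Fin 3), ‖v‖ = 1 ∧ ‖w‖ = 1 ∧ inner ℝ v w = 0 ∧ ∀ α β : ℝ, (-t) * inner ℝ (fderiv ℝ (u t) x (α • v + β • w)) (α • v + β • w) ≤ a * (α^2 + β^2))

/-- Membership in the Type-I model class `𝒦_C`: H1 ∧ H2 ∧ H3 ∧ H4 ∧ H5. -/
def InClass (C : ℝ) (u : ℝ → ℝ³ → ℝ³) : Prop :=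
  H1 u ∧ H2 u ∧ H3 u ∧ H4 C u ∧ H5 C u

/-- The conclusion of the crux: `u ≡ 0` on `t < 0`. -/
def VanishesOnPast (u : ℝ → ℝ³ → ℝ³) : Prop :=
  ∀ t < 0, ∀ x, u t x = 0

/-- **Read-back.** The crux is, definitionally, `InClass C u → H6 (1/8) u → u ≡ 0 on t < 0`. -/
theorem mustSqueeze_iff :
    MustSqueeze ↔ ∀ (C : ℝ) (u : ℝ → ℝ³ → ℝ³), InClass C u → H6 (1/8) u → VanishesOnPast u :=
  Iff.rfl

/-- H6 in the Leray-gauge vocabulary of `LerayGaugeStrainSpectrum`: `Λ_u(t,x) ≤ a` everywhere. -/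
theorem h6_iff_lerayMiddleStrain_le (a : ℝ) (u : ℝ → ℝ³ → ℝ³) :
    H6 a u ↔ ∀ t < 0, ∀ x, lerayMiddleStrain u t x ≤ a := by
  refine forall_congr' fun t => forall_congr' fun ht => forall_congr' fun x => ?_
  rw [lerayMiddleStrain_le_iff ht]

/-- Degenerate instance `C ≤ 0`: H4 alone forces `u ≡ 0`, so the crux holds trivially there
(the class is empty for `C < 0` and `{0}` for `C = 0`).  Intended under `∀ C`; not a defect. -/
theorem vanishes_of_h4_nonpos {C : ℝ} (hC : C ≤ 0) {u : ℝ → ℝ³ → ℝ³} (h4 : H4 C u) :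
    VanishesOnPast u := by
  intro t ht x
  have h := h4 t ht x
  have hs : 0 < Real.sqrt (-t) := Real.sqrt_pos.2 (by linarith)
  have : C / Real.sqrt (-t) ≤ 0 := div_nonpos_of_nonpos_of_nonneg hC hs.le
  exact norm_le_zero_iff.1 (h.trans this)

/-- The crux restricted to `C ≤ 0` is true for trivial reasons. -/
theorem mustSqueeze_holds_of_nonpos (C : ℝ) (hC : C ≤ 0) (u : ℝ → ℝ³ → ℝ³) (hu : InClass C u)
    (_h6 : H6 (1 / 8) u) : VanishesOnPast u :=
  vanishes_of_h4_nonpos hC hu.2.2.2.1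

/-! ### The zero field is a member (hypotheses satisfiable; conclusion also satisfied) -/

/-- `e₀, e₁`: an orthonormal pair in `ℝ³`. -/
theorem orthonormal_pair :
    ‖(EuclideanSpace.single 0 1 : ℝ³)‖ = 1 ∧ ‖(EuclideanSpace.single 1 1 : ℝ³)‖ = 1 ∧
      inner ℝ (EuclideanSpace.single 0 1 : ℝ³) (EuclideanSpace.single 1 1 : ℝ³) = 0 := by
  refine ⟨by simp, by simp, ?_⟩
  rw [EuclideanSpace.inner_single_left]
  simp

/-- A field whose every time slice has zero gradient satisfies H6 for every `a ≥ 0`. -/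
theorem h6_of_fderiv_eq_zero {a : ℝ} (ha : 0 ≤ a) {u : ℝ → ℝ³ → ℝ³}
    (h : ∀ t < 0, ∀ x, fderiv ℝ (u t) x = 0) : H6 a u := by
  intro t ht x
  refine ⟨EuclideanSpace.single 0 1, EuclideanSpace.single 1 1, orthonormal_pair.1,
    orthonormal_pair.2.1, orthonormal_pair.2.2, fun α β => ?_⟩
  rw [h t ht x]
  simp only [zero_apply, inner_zero_left, mul_zero]
  positivity

/-- The zero field lies in `𝒦_C` for every `C ≥ 0` and is squeezed: the hypotheses of the crux
are satisfiable (not vacuous), and the witness also satisfies the conclusion. -/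
theorem inClass_zero {C : ℝ} (hC : 0 ≤ C) : InClass C (fun _ _ => 0) ∧ H6 (1 / 8) (fun _ _ => 0) := by
  refine ⟨⟨?_, ?_, ?_, ?_, ?_⟩, ?_⟩
  · exact contDiffOn_const
  · intro t _ x
    simp [VectorCalculus.divergence]
  · intro s t _ _ x
    have h0 : Literature.Analysis.FluidPDE.heatFlow (fun _ : ℝ³ => (0 : ℝ³)) (t - s) = fun _ => 0 := by
      by_cases hts : 0 < t - s
      · rw [heatFlow_of_pos _ hts]
        funext y
        rw [heatExtension_apply]
        simp
      · exact heatFlow_of_nonpos _ (not_lt.1 hts)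
    simp [oseenIntegrand, h0]
  · intro t ht x
    have hs : 0 < Real.sqrt (-t) := Real.sqrt_pos.2 (by linarith)
    simpa using div_nonneg hC hs.le
  · intro x₀ t₀ r _ hr
    refine ⟨fun t _ _ => ?_, ?_⟩
    · simpa using by positivity
    · simpa using by positivity
  · exact h6_of_fderiv_eq_zero (by norm_num) fun t _ x => by simp


/-! ## §1 Load-bearing analysis, normalisation clauses: constants are KNSS-mild -/

/-- The written-out Oseen integrand of H3 evaluated on a CONSTANT field `u ≡ c`, as a function of
`z = x − y`. -/
def constKernel (c : ℝ³) (t τ : ℝ) (z : ℝ³) : ℝ³ :=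
  ((-(inner ℝ z c / (2*(t-τ)) * heatKernel (t-τ) z)) • c +
    (∫ σ in Set.Ioi (t-τ), heatKernel σ z / (4*σ^2)) • (inner ℝ z c • c + inner ℝ c c • z + inner ℝ z c • c) -
    ((∫ σ in Set.Ioi (t-τ), heatKernel σ z / (8*σ^3)) * (inner ℝ z c * inner ℝ z c)) • z)

theorem oseenIntegrand_const (c : ℝ³) (t τ : ℝ) (x y : ℝ³) :
    oseenIntegrand (fun _ _ => c) t τ x y = constKernel c t τ (x - y) := rfl

/-- The Gauss–Weierstrass kernel is even. -/
theorem heatKernel_neg (σ : ℝ) (z : ℝ³) : heatKernel σ (-z) = heatKernel σ z := by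
  simp [heatKernel, norm_neg]

/-- The constant-field Oseen integrand is ODD in `z = x − y` (every term carries an odd number of
factors `z`, the kernel factors being even). -/
theorem constKernel_neg (c : ℝ³) (t τ : ℝ) (z : ℝ³) :
    constKernel c t τ (-z) = -constKernel c t τ z := by
  simp only [constKernel, heatKernel_neg, inner_neg_left, neg_div, neg_neg, neg_mul, mul_neg,
    neg_smul, smul_neg]
  module

/-- Hence its space integral vanishes — by reflection and translation invariance of Lebesgue
measure alone: NO integrability input is needed (both invariances hold for the Bochner integral of
an arbitrary integrand). -/
theorem integral_oseenIntegrand_const (c : ℝ³) (t τ : ℝ) (x : ℝ³) :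
    ∫ y, oseenIntegrand (fun _ _ => c) t τ x y = 0 := by
  simp only [oseenIntegrand_const]
  rw [integral_sub_left_eq_self (constKernel c t τ) volume x]
  have h := integral_neg_eq_self (constKernel c t τ) volume
  simp only [constKernel_neg, integral_neg] at h
  have h2 : (2 : ℝ) • ∫ a, constKernel c t τ a = 0 := by
    rw [two_smul]
    nth_rw 1 [← h]
    exact neg_add_cancel _
  exact (smul_eq_zero.1 h2).resolve_left two_ne_zero

/-- `e^{τΔ} c = c` for a constant (`∫ heatKernel = 1`; for `τ ≤ 0` by the junk convention). -/
theorem heatFlow_const (c : ℝ³) (τ : ℝ) :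
    Literature.Analysis.FluidPDE.heatFlow (fun _ : ℝ³ => c) τ = fun _ => c := by
  by_cases hτ : 0 < τ
  · rw [heatFlow_of_pos _ hτ]
    funext x
    rw [heatExtension_apply, integral_smul_const, integral_heatKernel_eq_one_holds hτ, one_smul]
  · exact heatFlow_of_nonpos _ (not_lt.1 hτ)

/-- **Constants are KNSS-mild.** Every constant field satisfies the typed Oseen clause H3. -/
theorem isKNSSMild_const (c : ℝ³) : H3 (fun _ _ => c) := by
  intro s t _ _ x
  rw [heatFlow_const]
  simp [integral_oseenIntegrand_const]

/-- Constants are smooth, divergence free and squeezed (`Λ ≡ 0`). -/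
theorem h1_h2_h6_const (c : ℝ³) : H1 (fun _ _ => c) ∧ H2 (fun _ _ => c) ∧ H6 (1 / 8) (fun _ _ => c) := by
  refine ⟨contDiffOn_const, ?_, ?_⟩
  · intro t _ x
    simp [VectorCalculus.divergence]
  · exact h6_of_fderiv_eq_zero (by norm_num) fun t _ x => by simp

/-- The crux with BOTH normalisation clauses H4 (Type-I rate) and H5 (scaled energies) deleted. -/
def MustSqueezeWithoutH4H5 : Prop :=
  ∀ u : ℝ → ℝ³ → ℝ³, H1 u ∧ H2 u ∧ H3 u → H6 (1 / 8) u → VanishesOnPast u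

/-- **Any proof must use H4 or H5**: without them the nonzero constant `u ≡ e₀` is a smooth,
divergence-free, KNSS-mild, everywhere-squeezed field.  (Constants fail H4 as `t → −∞` and fail
H5 for large `r`; dropping only ONE of H4/H5 leaves a statement of open-problem strength — a
nonzero witness would be a genuine ancient mild solution, cf. `whyItResists`.) -/
theorem mustSqueeze_false_without_H4H5 : ¬ MustSqueezeWithoutH4H5 := by
  intro h
  have h0 : (EuclideanSpace.single 0 1 : ℝ³) = 0 :=
    h (fun _ _ => EuclideanSpace.single 0 1) ⟨(h1_h2_h6_const _).1, (h1_h2_h6_const _).2.1,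
      isKNSSMild_const _⟩ (h1_h2_h6_const _).2.2 (-1) (by norm_num) 0
  have h1 : ‖(EuclideanSpace.single 0 1 : ℝ³)‖ = 1 := by simp
  rw [h0, norm_zero] at h1
  exact zero_ne_one h1


/-! ## §2 Load-bearing analysis, the PDE clause: the crux without H3 is FALSE

Witness (gen-1 v3, re-proved here): the Gaussian vortex
`wit t x = (1/8)·e^{t/2}·e^{−‖x‖²}·(x₀e₁ − x₁e₀)` — a rigidly decaying solid-body-like swirl about
the `e₂`-axis with Gaussian envelope.  It satisfies H1, H2, H4, H5, H6 with one explicit constant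
`Cw` and is not zero; it is of course not a Navier–Stokes solution (H3 fails). -/

section DropH3

/-- `e₀`. -/
def e0 : ℝ³ := EuclideanSpace.single 0 1
/-- `e₁`. -/
def e1 : ℝ³ := EuclideanSpace.single 1 1

/-- The rotation generator about the `e₂`-axis, `rot x = x₀ e₁ − x₁ e₀` (a bounded linear map). -/
def rot : ℝ³ →L[ℝ] ℝ³ :=
  (EuclideanSpace.proj (0 : Fin 3) : ℝ³ →L[ℝ] ℝ).smulRight e1 -
    (EuclideanSpace.proj (1 : Fin 3) : ℝ³ →L[ℝ] ℝ).smulRight e0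

theorem rot_apply (x : ℝ³) : rot x = x 0 • e1 - x 1 • e0 := rfl

theorem rot_coord (x : ℝ³) : rot x 0 = -x 1 ∧ rot x 1 = x 0 ∧ rot x 2 = 0 := by
  refine ⟨?_, ?_, ?_⟩ <;> simp [rot_apply, e0, e1]

theorem real_inner_fin_three (x y : ℝ³) : inner ℝ x y = x 0 * y 0 + x 1 * y 1 + x 2 * y 2 := by
  simp [PiLp.inner_apply, Fin.sum_univ_three, mul_comm]

theorem inner_rot_self (x : ℝ³) : inner ℝ (rot x) x = 0 := by
  rw [real_inner_fin_three, (rot_coord x).1, (rot_coord x).2.1, (rot_coord x).2.2]; ring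

theorem inner_self_rot (x : ℝ³) : inner ℝ x (rot x) = 0 := by
  rw [real_inner_comm, inner_rot_self]

theorem norm_rot_le (x : ℝ³) : ‖rot x‖ ≤ ‖x‖ := by
  have h1 : ‖rot x‖ ^ 2 = x 1 ^ 2 + x 0 ^ 2 := by
    rw [EuclideanSpace.real_norm_sq_eq, Fin.sum_univ_three, (rot_coord x).1, (rot_coord x).2.1,
      (rot_coord x).2.2]; ring
  have h2 : ‖x‖ ^ 2 = x 0 ^ 2 + x 1 ^ 2 + x 2 ^ 2 := by
    rw [EuclideanSpace.real_norm_sq_eq, Fin.sum_univ_three]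
  have h3 : ‖rot x‖ ^ 2 ≤ ‖x‖ ^ 2 := by rw [h1, h2]; nlinarith [sq_nonneg (x 2)]
  exact (pow_le_pow_iff_left₀ (norm_nonneg _) (norm_nonneg _) two_ne_zero).1 h3

theorem rot_e0 : rot e0 = e1 := by
  rw [rot_apply]; simp [e0, e1]

theorem e1_ne_zero : e1 ≠ 0 := by
  intro h
  have : ‖e1‖ = 1 := by simp [e1]
  rw [h, norm_zero] at this
  exact zero_ne_one this

/-- The Gaussian envelope `e^{−‖x‖²}`. -/
def gauss (x : ℝ³) : ℝ := Real.exp (-‖x‖ ^ 2)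

theorem gauss_pos (x : ℝ³) : 0 < gauss x := Real.exp_pos _

theorem gauss_le_one (x : ℝ³) : gauss x ≤ 1 :=
  Real.exp_le_one_iff.2 (neg_nonpos.2 (sq_nonneg _))

/-- `2 s e^{−s} ≤ 1` for `s ≥ 0` (from `e^s ≥ 1 + s + s²/2`). -/
theorem two_mul_mul_exp_neg_le_one {s : ℝ} (hs : 0 ≤ s) : 2 * s * Real.exp (-s) ≤ 1 := by
  have h := Real.quadratic_le_exp_of_nonneg hs
  have h2 : 2 * s ≤ Real.exp s := by nlinarith [sq_nonneg (s - 1)]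
  rw [Real.exp_neg, mul_inv_le_iff₀ (Real.exp_pos _)]
  linarith

/-- `τ e^{−τ/2} ≤ 1` for `τ ≥ 0` (from `e^{τ/2} ≥ 1 + τ/2 + τ²/8 ≥ τ`). -/
theorem mul_exp_neg_half_le_one {τ : ℝ} (hτ : 0 ≤ τ) : τ * Real.exp (-τ / 2) ≤ 1 := by
  have h := Real.quadratic_le_exp_of_nonneg (by positivity : 0 ≤ τ / 2)
  have h2 : τ ≤ Real.exp (τ / 2) := by nlinarith [sq_nonneg (τ / 2 - 1)]
  rw [show -τ / 2 = -(τ / 2) by ring, Real.exp_neg, mul_inv_le_iff₀ (Real.exp_pos _)]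
  linarith

/-- `√τ · e^{−τ/2} ≤ 1` for `τ ≥ 0` (from `e^{τ} ≥ 1 + τ ≥ τ`). -/
theorem sqrt_mul_exp_neg_half_le_one {τ : ℝ} (hτ : 0 ≤ τ) : Real.sqrt τ * Real.exp (-τ / 2) ≤ 1 := by
  have h1 : τ * Real.exp (-τ) ≤ 1 := by
    have h := Real.add_one_le_exp τ
    rw [Real.exp_neg, mul_inv_le_iff₀ (Real.exp_pos _)]
    linarith
  have h2 : Real.exp (-τ / 2) = Real.sqrt (Real.exp (-τ)) := by
    rw [show -τ / 2 = -τ / 2 from rfl, ← Real.exp_half]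
  rw [h2, ← Real.sqrt_mul hτ]
  calc Real.sqrt (τ * Real.exp (-τ)) ≤ Real.sqrt 1 := Real.sqrt_le_sqrt h1
    _ = 1 := Real.sqrt_one

theorem two_mul_norm_sq_mul_gauss_le_one (x : ℝ³) : 2 * (‖x‖ ^ 2 * gauss x) ≤ 1 := by
  have := two_mul_mul_exp_neg_le_one (sq_nonneg ‖x‖)
  simpa [gauss, mul_assoc] using this

theorem norm_mul_gauss_le_one (x : ℝ³) : ‖x‖ * gauss x ≤ 1 := by
  have h1 : ‖x‖ ≤ ‖x‖ ^ 2 + 1 := by nlinarith [sq_nonneg (‖x‖ - 1 / 2)]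
  have h2 : ‖x‖ ^ 2 + 1 ≤ Real.exp (‖x‖ ^ 2) := Real.add_one_le_exp _
  rw [gauss, Real.exp_neg, mul_inv_le_iff₀ (Real.exp_pos _)]
  linarith

/-- `g² ‖x‖² ≤ g`: the squared witness is dominated by ONE Gaussian. -/
theorem gauss_sq_mul_norm_sq_le (x : ℝ³) : gauss x ^ 2 * ‖x‖ ^ 2 ≤ gauss x := by
  have h := two_mul_norm_sq_mul_gauss_le_one x
  have hg := gauss_pos x
  nlinarith [mul_pos hg hg]

/-- `g² (1 + 2‖x‖²)² ≤ 16 g`: the squared gradient of the witness is dominated by `16` Gaussians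
(`(1+2s)² ≤ (4+2s)² = 16(1+s/2)² ≤ 16 e^{s}`). -/
theorem gauss_sq_mul_poly_le (x : ℝ³) : gauss x ^ 2 * (1 + 2 * ‖x‖ ^ 2) ^ 2 ≤ 16 * gauss x := by
  set s : ℝ := ‖x‖ ^ 2 with hs
  have hs0 : 0 ≤ s := sq_nonneg _
  have h1 : s / 2 + 1 ≤ Real.exp (s / 2) := Real.add_one_le_exp _
  have h2 : (s / 2 + 1) ^ 2 ≤ Real.exp (s / 2) ^ 2 := pow_le_pow_left₀ (by positivity) h1 2
  have h3 : Real.exp (s / 2) ^ 2 = Real.exp s := by rw [sq, ← Real.exp_add]; ring_nf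
  have h4 : (1 + 2 * s) ^ 2 ≤ 16 * Real.exp s := by nlinarith
  have hg : gauss x * Real.exp s = 1 := by rw [gauss, ← hs, Real.exp_neg, inv_mul_cancel₀ (Real.exp_pos _).ne']
  have hgp := gauss_pos x
  calc gauss x ^ 2 * (1 + 2 * s) ^ 2 ≤ gauss x ^ 2 * (16 * Real.exp s) := by gcongr
    _ = 16 * gauss x * (gauss x * Real.exp s) := by ring
    _ = 16 * gauss x := by rw [hg, mul_one]

/-- The Gaussian is integrable on `ℝ³` (Mathlib's `∫ e^{−b‖v‖²} = (π/b)^{n/2} ≠ 0`). -/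
theorem integrable_gauss : Integrable gauss := by
  have h := GaussianFourier.integral_rexp_neg_mul_sq_norm (V := ℝ³) (b := 1) one_pos
  have hne : ∫ v : ℝ³, Real.exp (-1 * ‖v‖ ^ 2) ≠ 0 := by
    rw [h]; positivity
  have hi : Integrable (fun v : ℝ³ => Real.exp (-1 * ‖v‖ ^ 2)) := Integrable.of_integral_ne_zero hne
  refine hi.congr (Filter.Eventually.of_forall fun v => ?_)
  simp [gauss]

/-- `IG = ∫ e^{−‖x‖²} dx` (`= π^{3/2}`, value not needed). -/
def IG : ℝ := ∫ x, gauss x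

theorem IG_nonneg : 0 ≤ IG := integral_nonneg fun x => (gauss_pos x).le

/-- `V₁ = |B₁|`, the volume of the unit ball of `ℝ³` (`= 4π/3`, value not needed). -/
def V1 : ℝ := (volume (Metric.ball (0 : ℝ³) 1)).toReal

theorem V1_nonneg : 0 ≤ V1 := ENNReal.toReal_nonneg

theorem volume_ball_toReal (x₀ : ℝ³) {r : ℝ} (hr : 0 < r) :
    (volume (Metric.ball x₀ r)).toReal = r ^ 3 * V1 := by
  rw [Measure.addHaar_ball_of_pos volume x₀ hr, ENNReal.toReal_mul, finrank_euclideanSpace_fin,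
    ENNReal.toReal_ofReal (by positivity), V1]

/-- The vortex `w(x) = e^{−‖x‖²} rot x`. -/
def vortexW (x : ℝ³) : ℝ³ := gauss x • rot x

/-- Its Fréchet derivative `Dw(x) h = g(x) rot h − 2 g(x) ⟪x, h⟫ rot x`. -/
def DW (x : ℝ³) : ℝ³ →L[ℝ] ℝ³ :=
  gauss x • rot + ((gauss x * (-2 : ℝ)) • innerSL ℝ x).smulRight (rot x)

theorem hasFDerivAt_gauss (x : ℝ³) : HasFDerivAt gauss ((gauss x * (-2 : ℝ)) • innerSL ℝ x) x := by
  have h1 : HasFDerivAt (fun x : ℝ³ => -‖x‖ ^ 2) (-(2 • innerSL ℝ x)) x :=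
    (hasStrictFDerivAt_norm_sq x).hasFDerivAt.neg
  have h2 := (Real.hasDerivAt_exp (-‖x‖ ^ 2)).comp_hasFDerivAt x h1
  have h3 : Real.exp (-‖x‖ ^ 2) • -(2 • innerSL ℝ x) = (gauss x * (-2 : ℝ)) • innerSL ℝ x := by
    ext h
    simp [gauss]
    ring
  exact h2.congr_fderiv h3

theorem hasFDerivAt_vortexW (x : ℝ³) : HasFDerivAt vortexW (DW x) x := by
  have h := (hasFDerivAt_gauss x).smul (rot.hasFDerivAt (x := x))
  exact h

theorem DW_apply (x h : ℝ³) :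
    DW x h = gauss x • rot h + (gauss x * (-2) * inner ℝ x h) • rot x := by
  simp only [DW, add_apply, FunLike.coe_smul, Pi.smul_apply,
    ContinuousLinearMap.smulRight_apply, innerSL_apply_apply, smul_eq_mul]

theorem inner_DW_apply_self (x h : ℝ³) :
    inner ℝ (DW x h) h = gauss x * (-2) * inner ℝ x h * inner ℝ (rot x) h := by
  rw [DW_apply, inner_add_left, real_inner_smul_left, real_inner_smul_left, inner_rot_self, mul_zero,
    zero_add]

theorem abs_inner_DW_apply_self_le (x h : ℝ³) :
    |inner ℝ (DW x h) h| ≤ 2 * (‖x‖ ^ 2 * gauss x) * ‖h‖ ^ 2 := by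
  rw [inner_DW_apply_self]
  have hg := gauss_pos x
  have h1 : |inner ℝ x h| ≤ ‖x‖ * ‖h‖ := abs_real_inner_le_norm x h
  have h2 : |inner ℝ (rot x) h| ≤ ‖x‖ * ‖h‖ :=
    (abs_real_inner_le_norm _ _).trans (mul_le_mul_of_nonneg_right (norm_rot_le x) (norm_nonneg _))
  have key : |inner ℝ x h| * |inner ℝ (rot x) h| ≤ (‖x‖ * ‖h‖) * (‖x‖ * ‖h‖) :=
    mul_le_mul h1 h2 (abs_nonneg _) (by positivity)
  calc |gauss x * -2 * inner ℝ x h * inner ℝ (rot x) h|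
      = 2 * gauss x * (|inner ℝ x h| * |inner ℝ (rot x) h|) := by
        rw [abs_mul, abs_mul, abs_mul, abs_of_pos hg]; norm_num; ring
    _ ≤ 2 * gauss x * ((‖x‖ * ‖h‖) * (‖x‖ * ‖h‖)) := by gcongr
    _ = 2 * (‖x‖ ^ 2 * gauss x) * ‖h‖ ^ 2 := by ring

theorem norm_DW_le (x : ℝ³) : ‖DW x‖ ≤ gauss x * (1 + 2 * ‖x‖ ^ 2) := by
  have hg := gauss_pos x
  refine ContinuousLinearMap.opNorm_le_bound _ (by positivity) fun h => ?_
  rw [DW_apply]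
  calc ‖gauss x • rot h + (gauss x * -2 * inner ℝ x h) • rot x‖
      ≤ ‖gauss x • rot h‖ + ‖(gauss x * -2 * inner ℝ x h) • rot x‖ := norm_add_le _ _
    _ = gauss x * ‖rot h‖ + 2 * gauss x * |inner ℝ x h| * ‖rot x‖ := by
        rw [norm_smul, norm_smul, Real.norm_eq_abs, Real.norm_eq_abs, abs_of_pos hg, abs_mul, abs_mul,
          abs_of_pos hg, abs_neg, abs_two]
        ring
    _ ≤ gauss x * ‖h‖ + 2 * gauss x * (‖x‖ * ‖h‖) * ‖x‖ := by
        gcongr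
        · exact norm_rot_le h
        · exact abs_real_inner_le_norm x h
        · exact norm_rot_le x
    _ = gauss x * (1 + 2 * ‖x‖ ^ 2) * ‖h‖ := by ring

/-- The amplitude `1/8` (any `a ≤ 1/8` would do for H6 with threshold `1/8`). -/
def amp : ℝ := 1 / 8

theorem amp_pos : 0 < amp := by norm_num [amp]

theorem amp_le_one : amp ≤ 1 := by norm_num [amp]

/-- **The drop-H3 witness**: `wit t x = amp · e^{t/2} · e^{−‖x‖²} · rot x`. -/
def wit (t : ℝ) (x : ℝ³) : ℝ³ := (amp * Real.exp (t / 2)) • vortexW x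

theorem hasFDerivAt_wit (t : ℝ) (x : ℝ³) :
    HasFDerivAt (wit t) ((amp * Real.exp (t / 2)) • DW x) x :=
  (hasFDerivAt_vortexW x).const_smul (amp * Real.exp (t / 2))

theorem fderiv_wit (t : ℝ) (x : ℝ³) : fderiv ℝ (wit t) x = (amp * Real.exp (t / 2)) • DW x :=
  (hasFDerivAt_wit t x).fderiv

theorem coef_pos (t : ℝ) : 0 < amp * Real.exp (t / 2) := mul_pos amp_pos (Real.exp_pos _)

/-- Pointwise size: `‖wit t x‖ ≤ amp · e^{t/2}` and `‖wit t x‖² ≤ amp² e^{t} g(x) ≤ g(x)`. -/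
theorem norm_wit_le (t : ℝ) (x : ℝ³) : ‖wit t x‖ ≤ amp * Real.exp (t / 2) := by
  rw [wit, norm_smul, Real.norm_eq_abs, abs_of_pos (coef_pos t), vortexW, norm_smul, Real.norm_eq_abs,
    abs_of_pos (gauss_pos x)]
  have h : gauss x * ‖rot x‖ ≤ 1 := by
    calc gauss x * ‖rot x‖ ≤ gauss x * ‖x‖ := by gcongr; exacts [(gauss_pos x).le, norm_rot_le x]
      _ = ‖x‖ * gauss x := mul_comm _ _
      _ ≤ 1 := norm_mul_gauss_le_one x
  calc amp * Real.exp (t / 2) * (gauss x * ‖rot x‖) ≤ amp * Real.exp (t / 2) * 1 := by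
        gcongr; exact (coef_pos t).le
    _ = amp * Real.exp (t / 2) := mul_one _

theorem norm_wit_sq_le (t : ℝ) (x : ℝ³) : ‖wit t x‖ ^ 2 ≤ Real.exp t * gauss x := by
  rw [wit, norm_smul, Real.norm_eq_abs, abs_of_pos (coef_pos t), vortexW, norm_smul, Real.norm_eq_abs,
    abs_of_pos (gauss_pos x)]
  have h1 : (gauss x * ‖rot x‖) ^ 2 ≤ gauss x := by
    calc (gauss x * ‖rot x‖) ^ 2 = gauss x ^ 2 * ‖rot x‖ ^ 2 := by ring
      _ ≤ gauss x ^ 2 * ‖x‖ ^ 2 := by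
          gcongr; exact norm_rot_le x
      _ ≤ gauss x := gauss_sq_mul_norm_sq_le x
  have h2 : (amp * Real.exp (t / 2)) ^ 2 ≤ Real.exp t := by
    have : Real.exp (t / 2) ^ 2 = Real.exp t := by rw [sq, ← Real.exp_add]; ring_nf
    calc (amp * Real.exp (t / 2)) ^ 2 = amp ^ 2 * Real.exp (t / 2) ^ 2 := by ring
      _ ≤ 1 * Real.exp (t / 2) ^ 2 := by
          gcongr; · nlinarith [amp_pos, amp_le_one]
      _ = Real.exp t := by rw [one_mul, this]
  calc (amp * Real.exp (t / 2) * (gauss x * ‖rot x‖)) ^ 2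
      = (amp * Real.exp (t / 2)) ^ 2 * (gauss x * ‖rot x‖) ^ 2 := by ring
    _ ≤ Real.exp t * gauss x := mul_le_mul h2 h1 (by positivity) (Real.exp_pos t).le

theorem norm_fderiv_wit_sq_le (t : ℝ) (x : ℝ³) :
    ‖fderiv ℝ (wit t) x‖ ^ 2 ≤ Real.exp t * (16 * gauss x) := by
  rw [fderiv_wit, norm_smul, Real.norm_eq_abs, abs_of_pos (coef_pos t)]
  have h1 : ‖DW x‖ ^ 2 ≤ 16 * gauss x := by
    calc ‖DW x‖ ^ 2 ≤ (gauss x * (1 + 2 * ‖x‖ ^ 2)) ^ 2 :=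
          pow_le_pow_left₀ (norm_nonneg _) (norm_DW_le x) 2
      _ = gauss x ^ 2 * (1 + 2 * ‖x‖ ^ 2) ^ 2 := by ring
      _ ≤ 16 * gauss x := gauss_sq_mul_poly_le x
  have h2 : (amp * Real.exp (t / 2)) ^ 2 ≤ Real.exp t := by
    have : Real.exp (t / 2) ^ 2 = Real.exp t := by rw [sq, ← Real.exp_add]; ring_nf
    calc (amp * Real.exp (t / 2)) ^ 2 = amp ^ 2 * Real.exp (t / 2) ^ 2 := by ring
      _ ≤ 1 * Real.exp (t / 2) ^ 2 := by
          gcongr; · nlinarith [amp_pos, amp_le_one]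
      _ = Real.exp t := by rw [one_mul, this]
  calc (amp * Real.exp (t / 2) * ‖DW x‖) ^ 2 = (amp * Real.exp (t / 2)) ^ 2 * ‖DW x‖ ^ 2 := by ring
    _ ≤ Real.exp t * (16 * gauss x) := mul_le_mul h2 h1 (by positivity) (Real.exp_pos t).le

/-- The explicit class constant of the witness. -/
def Cw : ℝ := 1 + 17 * IG + V1

theorem one_le_Cw : 1 ≤ Cw := by
  have := IG_nonneg; have := V1_nonneg; rw [Cw]; nlinarith

/-- H1: the witness is smooth (globally, hence on `t < 0`). -/
theorem wit_h1 : H1 wit := by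
  have hs : ContDiff ℝ (⊤ : ℕ∞) (fun p : ℝ × ℝ³ => amp * Real.exp (p.1 / 2)) :=
    contDiff_const.mul (Real.contDiff_exp.comp (contDiff_fst.div_const 2))
  have hg : ContDiff ℝ (⊤ : ℕ∞) (fun p : ℝ × ℝ³ => gauss p.2) :=
    Real.contDiff_exp.comp ((contDiff_snd (E := ℝ) (F := ℝ³)).norm_sq ℝ).neg
  have hr : ContDiff ℝ (⊤ : ℕ∞) (fun p : ℝ × ℝ³ => rot p.2) := rot.contDiff.comp contDiff_snd
  have h : ContDiff ℝ (⊤ : ℕ∞) (fun p : ℝ × ℝ³ => (amp * Real.exp (p.1 / 2)) • (gauss p.2 • rot p.2)) :=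
    hs.smul (hg.smul hr)
  exact h.contDiffOn

/-- H2: the witness is divergence free (`div = −2g⟪x, rot x⟫ + g·tr rot = 0`). -/
theorem wit_h2 : H2 wit := by
  intro t _ x
  rw [VectorCalculus.divergence, fderiv_wit]
  have hb := divergence_eq_sum_inner_fderiv (EuclideanSpace.basisFun (Fin 3) ℝ) (wit t) x
  rw [VectorCalculus.divergence, fderiv_wit] at hb
  rw [hb, Fin.sum_univ_three]
  simp only [EuclideanSpace.basisFun_apply, FunLike.coe_smul, Pi.smul_apply,
    EuclideanSpace.inner_single_left]
  simp only [DW_apply, map_one, one_mul]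
  have hc := rot_coord x
  have h0 := rot_coord (EuclideanSpace.single (0 : Fin 3) (1 : ℝ) : ℝ³)
  have h1 := rot_coord (EuclideanSpace.single (1 : Fin 3) (1 : ℝ) : ℝ³)
  have h2 := rot_coord (EuclideanSpace.single (2 : Fin 3) (1 : ℝ) : ℝ³)
  simp only [PiLp.add_apply, PiLp.smul_apply, smul_eq_mul, hc.1, hc.2.1, hc.2.2, h0.1, h1.2.1, h2.2.2,
    EuclideanSpace.inner_single_right, PiLp.single_apply]
  simp
  ring

/-- H4: Type-I decay in time with constant `Cw` (`‖wit‖ ≤ amp e^{t/2} ≤ 1/√(−t)` as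
`√(−t) e^{t/2} ≤ 1`). -/
theorem wit_h4 : H4 Cw wit := by
  intro t ht x
  have hs : 0 < Real.sqrt (-t) := Real.sqrt_pos.2 (by linarith)
  rw [le_div_iff₀ hs]
  have h1 := norm_wit_le t x
  have h2 : Real.sqrt (-t) * Real.exp (t / 2) ≤ 1 := by
    have := sqrt_mul_exp_neg_half_le_one (by linarith : 0 ≤ -t)
    simpa [neg_neg] using this
  calc ‖wit t x‖ * Real.sqrt (-t) ≤ amp * Real.exp (t / 2) * Real.sqrt (-t) := by gcongr
    _ = amp * (Real.sqrt (-t) * Real.exp (t / 2)) := by ring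
    _ ≤ 1 * 1 := mul_le_mul amp_le_one h2 (by positivity) zero_le_one
    _ ≤ Cw := by rw [one_mul]; exact one_le_Cw

/-- Slice energy on a ball, large-ball bound: `∫_B ‖wit t‖² ≤ e^{t} IG`. -/
theorem setIntegral_norm_wit_sq_le (t : ℝ) (x₀ : ℝ³) (r : ℝ) :
    ∫ x in Metric.ball x₀ r, ‖wit t x‖ ^ 2 ≤ Real.exp t * IG := by
  have hi : Integrable (fun x => Real.exp t * gauss x) := integrable_gauss.const_mul _
  calc ∫ x in Metric.ball x₀ r, ‖wit t x‖ ^ 2 ≤ ∫ x in Metric.ball x₀ r, Real.exp t * gauss x := by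
        refine integral_mono_of_nonneg (Filter.Eventually.of_forall fun x => by positivity) hi.integrableOn
          (Filter.Eventually.of_forall fun x => norm_wit_sq_le t x)
    _ ≤ ∫ x, Real.exp t * gauss x :=
        setIntegral_le_integral hi (Filter.Eventually.of_forall fun x => by
          have := gauss_pos x; positivity)
    _ = Real.exp t * IG := by rw [integral_const_mul, IG]

/-- Slice energy on a ball, small-ball bound: `∫_B ‖wit t‖² ≤ r³ V₁` for `t ≤ 0`. -/
theorem setIntegral_norm_wit_sq_le' {t : ℝ} (ht : t ≤ 0) (x₀ : ℝ³) {r : ℝ} (hr : 0 < r) :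
    ∫ x in Metric.ball x₀ r, ‖wit t x‖ ^ 2 ≤ r ^ 3 * V1 := by
  have hpt : ∀ x, ‖wit t x‖ ^ 2 ≤ 1 := fun x => by
    calc ‖wit t x‖ ^ 2 ≤ Real.exp t * gauss x := norm_wit_sq_le t x
      _ ≤ 1 * 1 := mul_le_mul (Real.exp_le_one_iff.2 ht) (gauss_le_one x) (gauss_pos x).le zero_le_one
      _ = 1 := one_mul _
  have hfin : volume (Metric.ball x₀ r) ≠ ⊤ := measure_ball_lt_top.ne
  calc ∫ x in Metric.ball x₀ r, ‖wit t x‖ ^ 2 ≤ ∫ x in Metric.ball x₀ r, (1 : ℝ) :=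
        integral_mono_of_nonneg (Filter.Eventually.of_forall fun x => by positivity)
          (integrableOn_const hfin) (Filter.Eventually.of_forall hpt)
    _ = r ^ 3 * V1 := by rw [setIntegral_const, smul_eq_mul, mul_one, measureReal_def, volume_ball_toReal x₀ hr]

/-- Gradient energy on a ball: `∫_B ‖∇wit t‖² ≤ 16 e^{t} IG`. -/
theorem setIntegral_norm_fderiv_wit_sq_le (t : ℝ) (x₀ : ℝ³) (r : ℝ) :
    ∫ x in Metric.ball x₀ r, ‖fderiv ℝ (wit t) x‖ ^ 2 ≤ Real.exp t * (16 * IG) := by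
  have hi : Integrable (fun x => Real.exp t * (16 * gauss x)) := (integrable_gauss.const_mul _).const_mul _
  calc ∫ x in Metric.ball x₀ r, ‖fderiv ℝ (wit t) x‖ ^ 2
      ≤ ∫ x in Metric.ball x₀ r, Real.exp t * (16 * gauss x) :=
        integral_mono_of_nonneg (Filter.Eventually.of_forall fun x => by positivity) hi.integrableOn
          (Filter.Eventually.of_forall fun x => norm_fderiv_wit_sq_le t x)
    _ ≤ ∫ x, Real.exp t * (16 * gauss x) :=
        setIntegral_le_integral hi (Filter.Eventually.of_forall fun x => by
          have := gauss_pos x; positivity)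
    _ = Real.exp t * (16 * IG) := by rw [integral_const_mul, integral_const_mul, IG]

/-- `∫_{(t₀−r², t₀)} e^{t} dt = e^{t₀} − e^{t₀−r²} ≤ min(1, r²)` for `t₀ ≤ 0`. -/
theorem setIntegral_exp_Ioo_le {t₀ r : ℝ} (ht₀ : t₀ ≤ 0) :
    ∫ t in Set.Ioo (t₀ - r ^ 2) t₀, Real.exp t ≤ min 1 (r ^ 2) := by
  have hle : t₀ - r ^ 2 ≤ t₀ := by nlinarith [sq_nonneg r]
  have h : ∫ t in Set.Ioo (t₀ - r ^ 2) t₀, Real.exp t = Real.exp t₀ - Real.exp (t₀ - r ^ 2) := by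
    rw [← integral_Ioc_eq_integral_Ioo, ← intervalIntegral.integral_of_le hle, integral_exp]
  rw [h]
  refine le_min ?_ ?_
  · have h1 : Real.exp t₀ ≤ 1 := Real.exp_le_one_iff.2 ht₀
    have h2 : 0 < Real.exp (t₀ - r ^ 2) := Real.exp_pos _
    linarith
  · have h1 : Real.exp (t₀ - r ^ 2) = Real.exp t₀ * Real.exp (-r ^ 2) := by rw [← Real.exp_add]; ring_nf
    have h2 : -r ^ 2 + 1 ≤ Real.exp (-r ^ 2) := Real.add_one_le_exp _
    have h3 : Real.exp t₀ ≤ 1 := Real.exp_le_one_iff.2 ht₀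
    have h4 : 0 < Real.exp t₀ := Real.exp_pos _
    rw [h1]
    nlinarith

/-- H5: both scale-invariant local energies of the witness are `≤ Cw` on every backward parabolic
cylinder (the Gaussian mass handles `r ≥ 1`, the ball volume `r³V₁` and `∫e^t ≤ r²` handle `r < 1`). -/
theorem wit_h5 : H5 Cw wit := by
  intro x₀ t₀ r ht₀ hr
  have hIG := IG_nonneg
  have hV := V1_nonneg
  refine ⟨fun t _ ht => ?_, ?_⟩
  · -- slice energy
    have ht' : t ≤ 0 := by linarith
    rcases le_or_gt 1 r with hr1 | hr1
    · -- r ≥ 1: Gaussian mass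
      have h1 := setIntegral_norm_wit_sq_le t x₀ r
      have h2 : Real.exp t * IG ≤ IG := by
        calc Real.exp t * IG ≤ 1 * IG := by gcongr; exact Real.exp_le_one_iff.2 ht'
          _ = IG := one_mul _
      have h3 : r⁻¹ ≤ 1 := inv_le_one_of_one_le₀ hr1
      calc r⁻¹ * ∫ x in Metric.ball x₀ r, ‖wit t x‖ ^ 2 ≤ 1 * IG := by
            refine mul_le_mul h3 (h1.trans h2) ?_ zero_le_one
            exact integral_nonneg fun x => by positivity
        _ ≤ Cw := by rw [Cw]; nlinarith
    · -- r < 1: ball volume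
      have h1 := setIntegral_norm_wit_sq_le' ht' x₀ hr
      calc r⁻¹ * ∫ x in Metric.ball x₀ r, ‖wit t x‖ ^ 2 ≤ r⁻¹ * (r ^ 3 * V1) := by
            gcongr
        _ = r ^ 2 * V1 := by field_simp
        _ ≤ 1 * V1 := by gcongr; nlinarith
        _ ≤ Cw := by rw [Cw]; nlinarith
  · -- gradient energy
    have hinner : ∀ t, ∫ x in Metric.ball x₀ r, ‖fderiv ℝ (wit t) x‖ ^ 2 ≤ Real.exp t * (16 * IG) :=
      fun t => setIntegral_norm_fderiv_wit_sq_le t x₀ r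
    have hexp : IntegrableOn (fun t => Real.exp t * (16 * IG)) (Set.Ioo (t₀ - r ^ 2) t₀) :=
      ((Real.continuous_exp.mul continuous_const).integrableOn_Icc).mono_set Set.Ioo_subset_Icc_self
    have h1 : ∫ t in Set.Ioo (t₀ - r ^ 2) t₀, ∫ x in Metric.ball x₀ r, ‖fderiv ℝ (wit t) x‖ ^ 2 ≤
        ∫ t in Set.Ioo (t₀ - r ^ 2) t₀, Real.exp t * (16 * IG) :=
      integral_mono_of_nonneg (Filter.Eventually.of_forall fun t => integral_nonneg fun x => by positivity)
        hexp (Filter.Eventually.of_forall hinner)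
    have h2 : ∫ t in Set.Ioo (t₀ - r ^ 2) t₀, Real.exp t * (16 * IG) ≤ min 1 (r ^ 2) * (16 * IG) := by
      rw [integral_mul_const]
      exact mul_le_mul_of_nonneg_right (setIntegral_exp_Ioo_le ht₀) (by positivity)
    have h3 : r⁻¹ * (min 1 (r ^ 2)) ≤ 1 := by
      rcases le_or_gt 1 r with hr1 | hr1
      · calc r⁻¹ * min 1 (r ^ 2) ≤ 1 * 1 := by
              refine mul_le_mul (inv_le_one_of_one_le₀ hr1) (min_le_left _ _) (le_min zero_le_one (sq_nonneg _)) zero_le_one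
          _ = 1 := one_mul _
      · calc r⁻¹ * min 1 (r ^ 2) ≤ r⁻¹ * r ^ 2 := by gcongr; exact min_le_right _ _
          _ = r := by field_simp
          _ ≤ 1 := hr1.le
    calc r⁻¹ * ∫ t in Set.Ioo (t₀ - r ^ 2) t₀, ∫ x in Metric.ball x₀ r, ‖fderiv ℝ (wit t) x‖ ^ 2
        ≤ r⁻¹ * (min 1 (r ^ 2) * (16 * IG)) := by
          refine mul_le_mul_of_nonneg_left (h1.trans h2) (by positivity)
      _ = (r⁻¹ * min 1 (r ^ 2)) * (16 * IG) := by ring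
      _ ≤ 1 * (16 * IG) := by gcongr
      _ ≤ Cw := by rw [Cw]; nlinarith

/-- H6: the witness is squeezed, `Λ ≤ 1/8` everywhere (in the frame `e₀, e₁` — any frame works:
`|(−t)⟨∇wit h, h⟩| ≤ amp·[(−t)e^{t/2}]·[2‖x‖²e^{−‖x‖²}]·|h|² ≤ amp |h|²`). -/
theorem wit_h6 : H6 (1 / 8) wit := by
  intro t ht x
  refine ⟨e0, e1, by simp [e0], by simp [e1], by simp [e0, e1, EuclideanSpace.inner_single_left], fun α β => ?_⟩
  set h : ℝ³ := α • e0 + β • e1 with hh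
  have hnorm : ‖h‖ ^ 2 = α ^ 2 + β ^ 2 :=
    norm_sq_smul_add_smul (by simp [e0]) (by simp [e1]) (by simp [e0, e1, EuclideanSpace.inner_single_left]) α β
  rw [← hnorm, fderiv_wit, smul_apply, real_inner_smul_left]
  have ht' : 0 < -t := by linarith
  have h1 : |inner ℝ (DW x h) h| ≤ 2 * (‖x‖ ^ 2 * gauss x) * ‖h‖ ^ 2 := abs_inner_DW_apply_self_le x h
  have h2 : 2 * (‖x‖ ^ 2 * gauss x) ≤ 1 := two_mul_norm_sq_mul_gauss_le_one x
  have h3 : (-t) * Real.exp (t / 2) ≤ 1 := by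
    have := mul_exp_neg_half_le_one ht'.le
    simpa [neg_neg, neg_div] using this
  have h4 : inner ℝ (DW x h) h ≤ ‖h‖ ^ 2 := by
    calc inner ℝ (DW x h) h ≤ |inner ℝ (DW x h) h| := le_abs_self _
      _ ≤ 2 * (‖x‖ ^ 2 * gauss x) * ‖h‖ ^ 2 := h1
      _ ≤ 1 * ‖h‖ ^ 2 := by gcongr
      _ = ‖h‖ ^ 2 := one_mul _
  calc -t * (amp * Real.exp (t / 2) * inner ℝ (DW x h) h)
      = amp * ((-t) * Real.exp (t / 2)) * inner ℝ (DW x h) h := by ring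
    _ ≤ amp * ((-t) * Real.exp (t / 2)) * ‖h‖ ^ 2 := by
        refine mul_le_mul_of_nonneg_left h4 ?_
        exact mul_nonneg amp_pos.le (mul_nonneg ht'.le (Real.exp_pos _).le)
    _ ≤ amp * 1 * ‖h‖ ^ 2 := by gcongr; exact amp_pos.le
    _ = 1 / 8 * ‖h‖ ^ 2 := by rw [amp]; ring

/-- The witness is not zero: `wit (−1) e₀ = amp e^{−1/2} e^{−1} e₁ ≠ 0`. -/
theorem wit_ne_zero : wit (-1) e0 ≠ 0 := by
  rw [wit, vortexW, rot_e0, smul_smul]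
  exact smul_ne_zero (mul_pos (coef_pos _) (gauss_pos _)).ne' e1_ne_zero

/-- The crux with ONLY the KNSS-mild clause H3 deleted. -/
def MustSqueezeWithoutH3 : Prop :=
  ∀ (C : ℝ) (u : ℝ → ℝ³ → ℝ³), H1 u ∧ H2 u ∧ H4 C u ∧ H5 C u → H6 (1 / 8) u → VanishesOnPast u

/-- **Any proof must use the Oseen identity H3.** With H3 deleted the statement is false: the
Gaussian vortex `wit` satisfies every other clause with constant `Cw` and is not zero.  Read
together with §1: the typed side clauses H1, H2, H4, H5, H6 are jointly satisfiable by a nonzero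
smooth field, so they hide no junk — the crux is exactly as strong as its PDE content. -/
theorem mustSqueeze_false_without_H3 : ¬ MustSqueezeWithoutH3 := fun h =>
  wit_ne_zero (h Cw wit ⟨wit_h1, wit_h2, wit_h4, wit_h5⟩ wit_h6 (-1) (by norm_num) e0)

end DropH3

/-! ## §3 Exact sl(3) algebra: the engine's pointwise inequality, its sharp constant, and the
failure of the pointwise surrogate -/

/-- **Miller's Lemma 5.1 in eigenvalue coordinates.** For an ordered trace-free triple
`λ₁ ≥ λ₂ ≥ λ₃`, `−4 λ₁λ₂λ₃ ≤ 2 λ₂⁺ (λ₁² + λ₂² + λ₃²)`, i.e. `−4 det S ≤ 2 λ₂⁺ |S|²`: the local part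
of the enstrophy production carries the sign of the MIDDLE eigenvalue and at most the stated size. -/
theorem production_le_two_middle (l₁ l₂ l₃ : ℝ) (h12 : l₂ ≤ l₁) (h23 : l₃ ≤ l₂)
    (htr : l₁ + l₂ + l₃ = 0) :
    -4 * (l₁ * l₂ * l₃) ≤ 2 * max l₂ 0 * (l₁ ^ 2 + l₂ ^ 2 + l₃ ^ 2) := by
  rcases le_or_gt 0 l₂ with h2 | h2
  · rw [max_eq_left h2]
    have h3 : l₃ = -(l₁ + l₂) := by linarith
    subst h3
    have h1 : 0 ≤ l₁ := le_trans h2 h12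
    nlinarith [mul_nonneg h1 h2, sq_nonneg (l₁ - l₂), sq_nonneg (l₁ + l₂), mul_nonneg (mul_nonneg h1 h2) h1,
      mul_nonneg (mul_nonneg h1 h2) h2]
  · rw [max_eq_right h2.le]
    have h1 : l₁ = -(l₂ + l₃) := by linarith
    subst h1
    have h3 : l₃ < 0 := lt_of_le_of_lt h23 h2
    nlinarith [mul_pos (neg_pos.2 h2) (neg_pos.2 h3)]

/-- **The constant `2` is sharp** (approached at near-plane strain `(1, ε, −1−ε)`): for every
`c < 2` the inequality with `c` in place of `2` fails.  Consequently the engine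
`½Z′ + ‖∇Ω‖² + ¼Z ≤ 2·(sup Λ⁺)·½Z` closes exactly for `sup Λ < 1/4` and no better: the crux's
threshold `1/8` leaves the margin `1/8`, but `1/4` itself is the honest limit of this mechanism. -/
theorem production_const_sharp (c : ℝ) (hc : c < 2) :
    ∃ l₁ l₂ l₃ : ℝ, l₂ ≤ l₁ ∧ l₃ ≤ l₂ ∧ l₁ + l₂ + l₃ = 0 ∧
      c * max l₂ 0 * (l₁ ^ 2 + l₂ ^ 2 + l₃ ^ 2) < -4 * (l₁ * l₂ * l₃) := by
  rcases le_or_gt c 0 with hc0 | hc0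
  · refine ⟨1, 1, -2, le_rfl, by norm_num, by norm_num, ?_⟩
    rw [max_eq_left zero_le_one]
    nlinarith
  · set ε : ℝ := (2 - c) / 4 with hε
    have hε0 : 0 < ε := by rw [hε]; linarith
    have hε1 : ε ≤ 1 := by rw [hε]; linarith
    refine ⟨1, ε, -1 - ε, by linarith, by linarith, by ring, ?_⟩
    rw [max_eq_left hε0.le]
    have hcε : c = 2 - 4 * ε := by rw [hε]; ring
    rw [hcε]
    nlinarith [mul_pos hε0 hε0, mul_pos (mul_pos hε0 hε0) hε0, sq_nonneg ε]

/-- The vorticity vector of a velocity-gradient matrix `A i j = ∂ⱼ uᵢ` (route convention of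
`SignLaw`). -/
def vort (A : Matrix (Fin 3) (Fin 3) ℝ) : Fin 3 → ℝ := ![A 2 1 - A 1 2, A 0 2 - A 2 0, A 1 0 - A 0 1]

/-- The strain (symmetric part) `S = ½(A + Aᵀ)` (route convention). -/
def strain (A : Matrix (Fin 3) (Fin 3) ℝ) : Matrix (Fin 3) (Fin 3) ℝ := (1 / 2 : ℝ) • (A + A.transpose)

/-- The explicit trace-free gradient of gen-1 §3: axisymmetric strain `diag(1, −½, −½)` plus a
rotation of rate `2` about `e₀`. -/
def Asq : Matrix (Fin 3) (Fin 3) ℝ := !![1, 0, 0; 0, -1/2, -2; 0, 2, -1/2]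

/-- **The pointwise surrogate is false.**  `Asq` is trace free, its quadratic form on the plane
`e₁, e₂` is `−½|ξ|² ≤ (1/8)|ξ|²` (so a field with this gradient at gauge time `−t = 1` is squeezed
there, `Λ ≤ −½ ≤ 1/8`, indeed `λ₂(S) = −½ < 0`), yet the enstrophy production `ω·Sω = 16` is
strictly positive — it is entirely the null-Lagrangian part `4 det A − 4 det S = 17 − 1`.
Hence "Λ ≤ 1/8 ⇒ ω·Sω ≤ 2·(1/8)|S|²" fails pointwise; only after integration does `∫ 4 det ∇u`
drop out, and in a localised budget its flux `4∫u₁(∇u₂×∇u₃)·∇φ` is of leading order. -/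
theorem strain_apply (A : Matrix (Fin 3) (Fin 3) ℝ) (i j : Fin 3) :
    strain A i j = (1 / 2) * (A i j + A j i) := by
  simp [strain, Matrix.add_apply, Matrix.transpose_apply, Matrix.smul_apply]

theorem not_pointwise_surrogate :
    Asq.trace = 0 ∧
    (∀ α β : ℝ, dotProduct (α • ![0, 1, 0] + β • ![0, 0, 1]) (Asq.mulVec (α • ![0, 1, 0] + β • ![0, 0, 1]))
        = -(1 / 2) * (α ^ 2 + β ^ 2)) ∧
    dotProduct (vort Asq) ((strain Asq).mulVec (vort Asq)) = 16 ∧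
    4 * Asq.det - 4 * (strain Asq).det = 16 := by
  refine ⟨?_, ?_, ?_, ?_⟩
  · rw [Matrix.trace_fin_three]
    simp [Asq]
    norm_num
  · intro α β
    simp [Matrix.mulVec, dotProduct, Fin.sum_univ_three, Asq]
    ring
  · simp [Matrix.mulVec, dotProduct, Fin.sum_univ_three, vort, strain_apply, Asq]
    norm_num
  · rw [Matrix.det_fin_three, Matrix.det_fin_three]
    simp only [strain_apply]
    simp [Asq]
    norm_num

/-! ## §3b The quarter is Leray's exponent: the forward, finite-enstrophy skeleton of the engine -/

/-- **Forward-gauge comparison.** If `y` (think `y(t) = ‖ω(t)‖²_{L²}` of a finite-enstrophy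
solution on `[t₀, T)`) satisfies `(T − t)·y' ≤ 2a·y` — which is Miller's enstrophy law
`½y' = ∫ω·Sω − ‖∇ω‖² ≤ 2λ₂⁺_max ∫|S|² = λ₂⁺_max·y` under the FORWARD gauge squeeze
`(T − t)λ₂⁺ ≤ a` — then `y(t)(T − t)^{2a}` is non-increasing: `y(t) ≤ y(t₀)((T−t₀)/(T−t))^{2a}`. -/
theorem forward_gauge_comparison {y : ℝ → ℝ} {a T t₀ : ℝ}
    (hy : ∀ t ∈ Set.Ico t₀ T, DifferentiableAt ℝ y t)
    (hineq : ∀ t ∈ Set.Ico t₀ T, deriv y t * (T - t) ≤ 2 * a * y t) :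
    ∀ t ∈ Set.Ico t₀ T, y t * (T - t) ^ (2 * a) ≤ y t₀ * (T - t₀) ^ (2 * a) := by
  set g : ℝ → ℝ := fun t => y t * (T - t) ^ (2 * a) with hg
  have hgd : ∀ t ∈ Set.Ico t₀ T, HasDerivAt g
      (deriv y t * (T - t) ^ (2 * a) + y t * ((-1) * (2 * a) * (T - t) ^ (2 * a - 1))) t := by
    intro t ht
    have hTt : 0 < T - t := by linarith [ht.2]
    have h1 : HasDerivAt (fun t => T - t) (-1) t := by
      simpa using (hasDerivAt_id t).const_sub T
    have h2 : HasDerivAt (fun t => (T - t) ^ (2 * a)) ((-1) * (2 * a) * (T - t) ^ (2 * a - 1)) t :=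
      h1.rpow_const (Or.inl hTt.ne')
    exact ((hy t ht).hasDerivAt).mul h2
  have hanti : AntitoneOn g (Set.Ico t₀ T) := by
    refine antitoneOn_of_deriv_nonpos (convex_Ico t₀ T) ?_ ?_ ?_
    · exact fun t ht => (hgd t ht).continuousAt.continuousWithinAt
    · rw [interior_Ico]
      exact fun t ht => (hgd t (Set.Ioo_subset_Ico_self ht)).differentiableAt.differentiableWithinAt
    · rw [interior_Ico]
      intro t ht
      have ht' : t ∈ Set.Ico t₀ T := Set.Ioo_subset_Ico_self ht
      rw [(hgd t ht').deriv]
      have hTt : 0 < T - t := by linarith [ht.2]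
      have hpow : (T - t) ^ (2 * a) = (T - t) ^ (2 * a - 1) * (T - t) := by
        rw [← Real.rpow_add_one hTt.ne' (2 * a - 1)]; ring_nf
      have hp : 0 < (T - t) ^ (2 * a - 1) := Real.rpow_pos_of_pos hTt _
      have key : deriv y t * (T - t) ^ (2 * a) + y t * ((-1) * (2 * a) * (T - t) ^ (2 * a - 1))
          = (T - t) ^ (2 * a - 1) * (deriv y t * (T - t) - 2 * a * y t) := by
        rw [hpow]; ring
      rw [key]
      exact mul_nonpos_of_nonneg_of_nonpos hp.le (by linarith [hineq t ht'])
  intro t ht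
  have ht₀ : t₀ ∈ Set.Ico t₀ T := ⟨le_rfl, lt_of_le_of_lt ht.1 ht.2⟩
  exact hanti ht₀ ht ht.1

/-- **No Leray rate below the quarter.** With `a < 1/4` the comparison gives
`y(t) = O((T−t)^{−2a}) = o((T−t)^{−1/2})`, incompatible with Leray's lower bound
`‖∇u(t)‖²_{L²} ≥ c²(T − t)^{−1/2}` at a blow-up time (`c ≤ y√(T−t)`): in the forward,
finite-enstrophy setting "squeezed below ¼ in the gauge ⇒ no blow-up at `T`" is three lines
(Miller 2019/2020 enstrophy identity + Leray 1934 rate).  The crux is the ANCIENT, LOCAL-ENERGY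
version of exactly this, with the similarity enstrophy a priori infinite. -/
theorem no_leray_rate_of_subquarter {y : ℝ → ℝ} {a c T t₀ : ℝ} (ha : a < 1 / 4) (hc : 0 < c)
    (ht₀ : t₀ < T)
    (hy : ∀ t ∈ Set.Ico t₀ T, DifferentiableAt ℝ y t)
    (hineq : ∀ t ∈ Set.Ico t₀ T, deriv y t * (T - t) ≤ 2 * a * y t)
    (hleray : ∀ t ∈ Set.Ico t₀ T, c ≤ y t * Real.sqrt (T - t)) : False := by
  have hcomp := forward_gauge_comparison hy hineq
  set M : ℝ := y t₀ * (T - t₀) ^ (2 * a) with hM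
  set e : ℝ := 1 / 2 - 2 * a with he
  have he0 : 0 < e := by rw [he]; linarith
  -- along `[t₀, T)`: `c ≤ M (T - t)^e`
  have hbound : ∀ t ∈ Set.Ico t₀ T, c ≤ M * (T - t) ^ e := by
    intro t ht
    have hTt : 0 < T - t := by linarith [ht.2]
    have h1 : y t * (T - t) ^ (2 * a) ≤ M := hcomp t ht
    have h2 : c ≤ y t * Real.sqrt (T - t) := hleray t ht
    have hsqrt : Real.sqrt (T - t) = (T - t) ^ (2 * a) * (T - t) ^ e := by
      rw [Real.sqrt_eq_rpow, ← Real.rpow_add hTt]; congr 1; rw [he]; ring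
    have hpe : 0 < (T - t) ^ e := Real.rpow_pos_of_pos hTt _
    calc c ≤ y t * Real.sqrt (T - t) := h2
      _ = (y t * (T - t) ^ (2 * a)) * (T - t) ^ e := by rw [hsqrt]; ring
      _ ≤ M * (T - t) ^ e := mul_le_mul_of_nonneg_right h1 hpe.le
  -- `M > 0`
  have hM0 : 0 < M := by
    have h := hbound t₀ ⟨le_rfl, ht₀⟩
    have hpe : 0 < (T - t₀) ^ e := Real.rpow_pos_of_pos (by linarith) _
    by_contra hcon
    have : M * (T - t₀) ^ e ≤ 0 := mul_nonpos_of_nonpos_of_nonneg (not_lt.1 hcon) hpe.le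
    linarith
  -- choose `t` close to `T` with `M (T - t)^e < c`
  set d : ℝ := min (T - t₀) ((c / M) ^ (1 / e)) with hd
  have hcM : 0 < c / M := div_pos hc hM0
  have hd0 : 0 < d := lt_min (by linarith) (Real.rpow_pos_of_pos hcM _)
  set t : ℝ := T - d / 2 with ht
  have ht1 : t ∈ Set.Ico t₀ T := by
    refine ⟨?_, by rw [ht]; linarith⟩
    have : d ≤ T - t₀ := min_le_left _ _
    rw [ht]; linarith
  have hTt : T - t = d / 2 := by rw [ht]; ring
  have hlt : (T - t) ^ e < c / M := by
    rw [hTt]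
    have h1 : d / 2 < (c / M) ^ (1 / e) := by
      have : d ≤ (c / M) ^ (1 / e) := min_le_right _ _
      linarith
    have h2 : (d / 2) ^ e < ((c / M) ^ (1 / e)) ^ e :=
      Real.rpow_lt_rpow (by linarith) h1 he0
    rwa [← Real.rpow_mul hcM.le, one_div_mul_cancel he0.ne', Real.rpow_one] at h2
  have h3 : M * (T - t) ^ e < c := by
    calc M * (T - t) ^ e < M * (c / M) := mul_lt_mul_of_pos_left hlt hM0
      _ = c := by field_simp
  linarith [hbound t ht1]

/-- **At the quarter the rate saturates.** `y(t) = (T − t)^{−1/2}` satisfies the forward-gauge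
law with EQUALITY at `a = 1/4` and Leray's lower bound with `c = 1` for every `t < T`: the ODE
mechanism cannot exclude blow-up at `a = 1/4` (tightness of the threshold from the forward side;
cf. `production_const_sharp` for the pointwise side). -/
theorem quarter_rate_saturates (T : ℝ) :
    ∃ y : ℝ → ℝ, ∀ t < T, DifferentiableAt ℝ y t ∧
      deriv y t * (T - t) = 2 * (1 / 4) * y t ∧ 1 ≤ y t * Real.sqrt (T - t) := by
  refine ⟨fun t => (T - t) ^ (-(1 / 2 : ℝ)), fun t ht => ?_⟩
  have hTt : 0 < T - t := by linarith
  have h1 : HasDerivAt (fun t => T - t) (-1) t := by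
    simpa using (hasDerivAt_id t).const_sub T
  have h2 : HasDerivAt (fun t => (T - t) ^ (-(1 / 2 : ℝ)))
      ((-1) * (-(1 / 2 : ℝ)) * (T - t) ^ (-(1 / 2 : ℝ) - 1)) t :=
    h1.rpow_const (Or.inl hTt.ne')
  refine ⟨h2.differentiableAt, ?_, ?_⟩
  · rw [h2.deriv]
    have : (T - t) ^ (-(1 / 2 : ℝ) - 1) * (T - t) = (T - t) ^ (-(1 / 2 : ℝ)) := by
      rw [← Real.rpow_add_one hTt.ne']; ring_nf
    calc -1 * -(1 / 2 : ℝ) * (T - t) ^ (-(1 / 2 : ℝ) - 1) * (T - t)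
        = (1 / 2) * ((T - t) ^ (-(1 / 2 : ℝ) - 1) * (T - t)) := by ring
      _ = 2 * (1 / 4) * (T - t) ^ (-(1 / 2 : ℝ)) := by rw [this]; ring
  · rw [Real.sqrt_eq_rpow, ← Real.rpow_add hTt]
    norm_num

/-! ## §4 Kinematic bookkeeping of the crux ideas, certified -/

/-- `|ω|² = |A|²_F − tr(A²)` for every real `3 × 3` matrix (no trace condition needed): the
pointwise identity behind `∫|∇U|²φ = ∫|Ω|²φ − ∫((U·∇)U)·∇φ` (for `div U = 0`,
`tr((∇U)²) = div((U·∇)U)`), used by card leaky-quarter-law, step 2. -/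
theorem vorticity_sq_eq (A : Matrix (Fin 3) (Fin 3) ℝ) :
    dotProduct (vort A) (vort A) = (∑ i, ∑ j, A i j ^ 2) - (A * A).trace := by
  simp [vort, dotProduct, Fin.sum_univ_three, Matrix.trace_fin_three, Matrix.mul_apply]
  ring

/-- `|S|²_F = ½(|A|²_F + tr(A²))` for every real `3 × 3` matrix. -/
theorem strain_sq_eq (A : Matrix (Fin 3) (Fin 3) ℝ) :
    (∑ i, ∑ j, strain A i j ^ 2) = (1 / 2) * ((∑ i, ∑ j, A i j ^ 2) + (A * A).trace) := by
  simp [strain, Fin.sum_univ_three, Matrix.trace_fin_three, Matrix.mul_apply,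
    Matrix.transpose_apply, Matrix.add_apply, Matrix.smul_apply]
  ring

/-- `|S|² = ½|ω|² + tr(A²)`: integrating against a cutoff `φ` and using `tr((∇U)²) = div((U·∇)U)`
gives exactly the card's `∫|S|²φ = ½Z_φ − ∫((U·∇)U)·∇φ` (so `2a₀∫|S|²φ = a₀Z_φ + flux`, and the
bulk coefficient of the engine is `a₀` against the gain `¼`). -/
theorem strain_sq_eq_half_vorticity_add_trace_sq (A : Matrix (Fin 3) (Fin 3) ℝ) :
    (∑ i, ∑ j, strain A i j ^ 2) = (1 / 2) * dotProduct (vort A) (vort A) + (A * A).trace := by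
  rw [strain_sq_eq, vorticity_sq_eq]; ring


/-! ### §4b The signed drift and the ancient Grönwall engine (card leaky-quarter-law, audited) -/

/-- **The one flux of order `R` is signed.**  For a radial cutoff `φ = ψ ∘ ‖·‖²` with `ψ`
differentiable and non-increasing (`ψ' ≤ 0`), the Leray-drift weight is
`⟪∇φ(y), y⟫ = 2 ψ'(‖y‖²) ‖y‖² ≤ 0` at every `y`.  In the localised similarity-variable enstrophy
budget (re-derived by hand in this session from `∂ₛΩ + Ω + ½y·∇Ω + U·∇Ω = ΔΩ + SΩ`, testing with
`Ωφ`):  `½Z_φ' + ¼Z_φ + ∫|∇Ω|²φ = ∫(Ω·SΩ)φ + ¼∫|Ω|²(y·∇φ) + ½∫|Ω|²(U·∇φ) + ½∫|Ω|²Δφ`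
(the `¼ = 1 − ¾` and the `+¼∫|Ω|²(y·∇φ)` both come from `−∫Ω·(½y·∇Ω)φ = ¼∫|Ω|² div(yφ)`), so the
drift flux enters with a PLUS sign and a NON-POSITIVE weight: it may be dropped from an upper
bound for `Z_φ'`, exactly as the card claims.  SIGN CHECKED TWICE (similarity and physical
variables); a wrong sign here would have killed the card's pass 1. -/
theorem radial_cutoff_drift_nonpos {ψ ψ' : ℝ → ℝ} (hψ : ∀ r, HasDerivAt ψ (ψ' r) r)
    (hψ' : ∀ r, ψ' r ≤ 0) (y : ℝ³) :
    HasFDerivAt (fun z : ℝ³ => ψ (‖z‖ ^ 2)) (ψ' (‖y‖ ^ 2) • ((2 : ℕ) • innerSL ℝ y)) y ∧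
      (ψ' (‖y‖ ^ 2) • ((2 : ℕ) • innerSL ℝ y)) y = 2 * ψ' (‖y‖ ^ 2) * ‖y‖ ^ 2 ∧
      (ψ' (‖y‖ ^ 2) • ((2 : ℕ) • innerSL ℝ y)) y ≤ 0 := by
  have hval : (ψ' (‖y‖ ^ 2) • ((2 : ℕ) • innerSL ℝ y)) y = 2 * ψ' (‖y‖ ^ 2) * ‖y‖ ^ 2 := by
    simp
    ring
  refine ⟨(hψ _).comp_hasFDerivAt y (hasStrictFDerivAt_norm_sq y).hasFDerivAt, hval, ?_⟩
  rw [hval]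
  nlinarith [hψ' (‖y‖ ^ 2), sq_nonneg ‖y‖]

/-- **Ancient Grönwall** — the engine of BOTH passes of card leaky-quarter-law, certified.
If `z` is differentiable on `(−∞, s₀]` with `z' ≤ −c z + K` there (`c > 0`; in the card
`c = 2(¼ − a₀)`, `K` the `L¹`-in-time flux level), and `z ≤ B` at arbitrarily negative times (the
"good times" a time-averaged bound supplies by Chebyshev), then `z s₀ ≤ K / c`, uniformly in `B`:
ancientness plus bounds uniform in `s` forbid the backward exponential growth that `z s₀ > K/c`
forces.  (The card's version has `L¹_unif` forcing instead of a constant `K`; same proof with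
`∫K e^{cσ}` summed over unit intervals.) -/
theorem ancient_gronwall {z : ℝ → ℝ} {c K B s₀ : ℝ} (hc : 0 < c)
    (hz : ∀ s ≤ s₀, DifferentiableAt ℝ z s)
    (hineq : ∀ s ≤ s₀, deriv z s ≤ -c * z s + K)
    (hbdd : ∀ S : ℝ, ∃ s ≤ S, z s ≤ B) :
    z s₀ ≤ K / c := by
  set w : ℝ → ℝ := fun s => Real.exp (c * s) * (z s - K / c) with hw
  have hwd : ∀ s ≤ s₀, HasDerivAt w
      (c * Real.exp (c * s) * (z s - K / c) + Real.exp (c * s) * deriv z s) s := by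
    intro s hs
    have h1 : HasDerivAt (fun s => Real.exp (c * s)) (c * Real.exp (c * s)) s := by
      have := ((hasDerivAt_id' s).const_mul c).exp
      refine this.congr_deriv ?_
      ring
    have h2 : HasDerivAt (fun s => z s - K / c) (deriv z s) s := (hz s hs).hasDerivAt.sub_const _
    exact h1.mul h2
  have hanti : AntitoneOn w (Set.Iic s₀) := by
    refine antitoneOn_of_deriv_nonpos (convex_Iic s₀) ?_ ?_ ?_
    · exact fun s hs => (hwd s hs).continuousAt.continuousWithinAt
    · rw [interior_Iic]
      exact fun s hs => (hwd s (le_of_lt hs)).differentiableAt.differentiableWithinAt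
    · rw [interior_Iic]
      intro s hs
      rw [(hwd s (le_of_lt hs)).deriv]
      have hi := hineq s (le_of_lt hs)
      have he := Real.exp_pos (c * s)
      have h0 : c * Real.exp (c * s) * (z s - K / c) + Real.exp (c * s) * (-c * z s + K) = 0 := by
        field_simp
        ring
      nlinarith [mul_le_mul_of_nonneg_left hi he.le]
  by_contra hcon
  rw [not_le] at hcon
  set δ : ℝ := z s₀ - K / c with hδ
  have hδpos : 0 < δ := by rw [hδ]; linarith
  set M : ℝ := max (B - K / c) 0 with hM
  have htend : Filter.Tendsto (fun s : ℝ => Real.exp (c * s) * M) Filter.atBot (nhds 0) := by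
    have h1 : Filter.Tendsto (fun s : ℝ => c * s) Filter.atBot Filter.atBot :=
      Filter.tendsto_id.const_mul_atBot hc
    have h2 := Real.tendsto_exp_atBot.comp h1
    simpa using h2.mul_const M
  have hev : ∀ᶠ s in Filter.atBot, Real.exp (c * s) * M < Real.exp (c * s₀) * δ :=
    htend (Iio_mem_nhds (mul_pos (Real.exp_pos _) hδpos))
  obtain ⟨S, hS⟩ := Filter.eventually_atBot.1 hev
  obtain ⟨s, hsS, hzs⟩ := hbdd (min S s₀)
  have hs0 : s ≤ s₀ := hsS.trans (min_le_right _ _)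
  have hsS' : s ≤ S := hsS.trans (min_le_left _ _)
  have h1 : w s₀ ≤ w s := hanti (Set.mem_Iic.2 hs0) (Set.mem_Iic.2 le_rfl) hs0
  have h2 : w s ≤ Real.exp (c * s) * M :=
    mul_le_mul_of_nonneg_left ((sub_le_sub_right hzs _).trans (le_max_left _ _)) (Real.exp_pos _).le
  have h3 : w s₀ = Real.exp (c * s₀) * δ := rfl
  have h4 := hS s hsS'
  linarith

/-- **Good times from a time-averaged bound** — the Chebyshev step of pass 1 of card
leaky-quarter-law in the weakest form `ancient_gronwall` needs: if every unit-time integral of `z`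
is `≤ A` (for `Z_{φ_R}` this is H5b read in similarity variables, `A = C₄R`), then below every `S`
there is a time at which `z ≤ A` (first-moment method, `exists_le_setAverage`). -/
theorem exists_good_time {z : ℝ → ℝ} {A : ℝ} (hint : ∀ S, IntegrableOn z (Set.Icc (S - 1) S))
    (havg : ∀ S, ∫ s in Set.Icc (S - 1) S, z s ≤ A) (S : ℝ) : ∃ s ≤ S, z s ≤ A := by
  have h1 : volume.real (Set.Icc (S - 1) S) = 1 := by rw [measureReal_def, Real.volume_Icc]; simp
  have hμ : volume (Set.Icc (S - 1) S) ≠ 0 := by rw [Real.volume_Icc]; simp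
  have hμ' : volume (Set.Icc (S - 1) S) ≠ ⊤ := measure_Icc_lt_top.ne
  obtain ⟨s, hs, hle⟩ := exists_le_setAverage hμ hμ' (hint S)
  refine ⟨s, hs.2, hle.trans ?_⟩
  rw [setAverage_eq, h1]
  simpa using havg S

/-- **Pass 1 of the card, abstract form** (`exists_good_time` + `ancient_gronwall` chained): a
quantity obeying `z' ≤ −c z + K` on `(−∞, s₀]` whose unit-time integrals are uniformly bounded is
bounded at `s₀` by `K/c` — independently of the size `A` of the time-averaged bound (in the card
`A ∼ R` while `K/c` is `R`-independent, which is what lets `R → ∞`). -/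
theorem ancient_gronwall_of_time_average {z : ℝ → ℝ} {c K A s₀ : ℝ} (hc : 0 < c)
    (hz : ∀ s ≤ s₀, DifferentiableAt ℝ z s) (hineq : ∀ s ≤ s₀, deriv z s ≤ -c * z s + K)
    (hint : ∀ S, IntegrableOn z (Set.Icc (S - 1) S)) (havg : ∀ S, ∫ s in Set.Icc (S - 1) S, z s ≤ A) :
    z s₀ ≤ K / c :=
  ancient_gronwall hc hz hineq (exists_good_time hint havg)

/-! ## §5 Why the crux resists (and what would change the verdict)

**Status after four adversary generations (gen 1–4): no kill; the statement is more likely TRUE than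
false — it holds under (L) (§6), its forward finite-enstrophy analogue is a three-line theorem
(§3b), and the picked line's only witness-testable stub has exactly the load-bearing structure
the two-pass argument uses (§8).**

1. *What a counterexample is.*  By `mustSqueeze_iff`, a counterexample is a NONZERO element of
   the Type-I model class `𝒦_C` (H1–H5) with `(−t)λ₂(S) ≤ 1/8` everywhere.  A nonzero element of
   `𝒦_C` exists iff a Type-I singularity of Navier–Stokes exists (Albritton–Barker 2019, Thm 1.1,
   both directions; tree `AlbrittonBarkerTypeICharacterization`).  None is known; none of the
   numerically proposed singular scenarios (Hou 2022 axisymmetric, backward-DSS set-ups of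
   Bradshaw–Tsai OP 5.1) comes with a verified Type-I rate, let alone a computed gauge
   middle-eigenvalue field.  So an outright kill is out of reach of computation today, and every
   cheap family is excluded: constants (fail H4/H5, §1), drifting/caloric/shear modes (fail H3 or
   H5), linear strain flows `Mx/(−t)` (bilinear Oseen integrand non-integrable ⇒ Bochner junk
   `0` ⇒ H3 reduces to `u(t) = e^{(t−s)Δ}u(s)`, false unless `M = 0`), self-similar profiles
   (NRŠ 1996 / Tsai 1998 under the local energy bounds H5), 2-D and axisymmetric-no-swirl members
   (KNSS 2009 Thms 5.1–5.2, trivial), Landau (fails H1), Burgers-type strained vortices (steady,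
   infinite energy: fail H4 and H5b — note they DO realise `λ₂ < 0` with positive production
   `ω·Sω = α|ω|² > 0`, the continuum version of `not_pointwise_surrogate`: the energy identity
   balances only through flux from infinity, which is exactly what H5 forbids).
2. *No junk in the typing* (re-audited): every Bochner integral in H3 converges absolutely for a
   bounded smooth `u` (σ-integrals `≲ |z|^{−5}, |z|^{−7}`, `y`-integrand `O(|z|^{−4})` at infinity,
   `(t−τ)^{−1/2}` in `τ`); the slice/cylinder integrals of H5 are integrals of continuous functions
   on compact sets for `t₀ < 0` and pass to `t₀ = 0` by monotone convergence; `heatFlow`'s junk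
   branch `τ ≤ 0` is never reached (`t − s > 0`); `fderiv` junk never reached (H1); `(⊤ : ℕ∞)` is
   `C^∞`, not `C^ω`; `C ≤ 0` is trivially true (`mustSqueeze_holds_of_nonpos`) and intended.
   §1 + §2 show the remaining clauses are independent in the only way that matters: dropping the
   PDE (H3) or the normalisation (H4 ∧ H5) makes the statement false, so no proof can bypass them.
3. *Symmetries.*  All clauses are invariant under NS scaling, space translation, rotation
   (`Λ` is a spectral invariant) and backward time-shift `t ↦ t + a`, `a < 0` (H6 gains the factor
   `(−t)/(−t−a) < 1`); `u ↦ −u` maps `𝒦_C` to the mirror class of "anti-NS" and FLIPS H6 to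
   `λ₂ ≥ −1/8`, so it is not a symmetry — no normalisation can shrink `Λ`, and the sign of the
   Oseen term in H3 was re-derived independently three times (refuter notes on the item).
4. *Audit of card leaky-quarter-law (this session, by hand).*  (a) the cutoff identity of §4b
   is correct, drift weight `y·∇φ_R ≤ 0` enters with `+¼`: signed, droppable ✓; (b) Morrey
   translation: `∫_{B_ρ(y₀)}|U(s)|²dy ≤ Cρ` from H5a with `r = ρ√(−t)`, and
   `∫_s^{s+1}∫_{B_ρ}|∇U|² ≤ 2√e·C·ρ` for `ρ ≥ ½` from H5b on `Q_r(0, t₁/e)`, `r = 2ρ√(−t₁)` (the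
   card writes `2e`; only the constant differs) ✓; (c) `∫|S|²φ = ½Z_φ − ∫((U·∇)U)·∇φ` is the
   integrated form of `strain_sq_eq_half_vorticity_add_trace_sq` with `tr((∇U)²) = div((U·∇)U)`
   for `div U = 0` ✓; (d) every other flux is `(1/R) × (quantity whose unit-time integral is
   O(R))`, i.e. `O(1)` in `L¹_unif(s)`, uniformly in `R` — the cubic flux by
   `|4∫U₁(∇U₂×∇U₃)·∇φ| ≤ c‖U‖_∞R^{−1}∫_{B_{2R}}|∇U|²` and H4 ✓; (e) pass 1 (Chebyshev good times +
   `ancient_gronwall` with `L¹_unif` forcing) gives `sup_s ∫|Ω|²dy < ∞` for ANY `a₀ < ¼`, pass 2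
   sends the forcing to `0` ✓.  NO ERROR FOUND.  What remains for a Lean proof is the regularity
   package "KNSS-mild + H1 + H4 ⇒ classical vorticity equation in similarity variables with
   `|Ω| ≤ C₁(C)`" and the bookkeeping — labour, not risk.  Consequently the `1/8` of the crux is
   inessential (any threshold `< ¼` would do), while `production_const_sharp` shows `¼` is the
   honest limit of this mechanism.
5. *Audit of card singular-rate-squeeze.*  The exponent race `∫_0^{r²}θ^{−2a}dθ = o(r) ⇔ a < ¼`
   is correct; the line additionally needs the regular-collar lemma (AB 2019 Prop 2.4) and interior
   gradient bounds on the collar — plausible, more infrastructure than the leaky line.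
6. *What would change the verdict.*  (i) A nonzero Type-I ancient mild solution (kills the
   target `SqueezeLiouville` and conjecture (L) as well) — open problem; (ii) an element of `𝒦_C`
   for which the vorticity equation fails (impossible: KNSS-mild bounded ancient solutions are
   smooth classical solutions with pressure `RᵢRⱼ(uᵢuⱼ)`); (iii) a sign error in §4b (checked
   twice, and the Lean lemma pins the convention).  None is available; the adversary's advice to
   provers is to build the similarity-variable vorticity budget for `𝒦_C` and run the two passes.
-/

/-! ## §6 Reductions: what a refutation of the crux would refute -/

/-- The route target implies the crux: `MustSqueeze` is `SqueezeLiouville` with the extra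
hypothesis H6, which is simply not used. -/
theorem mustSqueeze_of_squeezeLiouville (hL : SqueezeLiouville) : MustSqueeze :=
  fun C u hu _ => hL C u hu

/-- **The crux holds under the Liouville conjecture (L)** of Koch–Nadirashvili–Seregin–Šverák
(tree: `Theorems.squeezeLiouville_of_liouvilleConjectureNS`, via the time-shifted bounded ancient
mild solution and `IsTypeIAncientMild.eq_zero_of_slice_const`).  CONDITIONAL — (L) is open. -/
theorem mustSqueeze_of_liouvilleConjectureNS (hL : LiouvilleConjectureNS) : MustSqueeze :=
  mustSqueeze_of_squeezeLiouville (Theorems.squeezeLiouville_of_liouvilleConjectureNS hL)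

/-- **Contrapositive, the adversary's bar.** A refutation of `MustSqueeze` is a refutation of
(L): the witness would be (after a time shift) a nonconstant bounded ancient mild solution —
equivalently (Albritton–Barker 2019, Thm 1.1) a Type-I singularity of Navier–Stokes. -/
theorem not_liouvilleConjectureNS_of_not_mustSqueeze (h : ¬ MustSqueeze) :
    ¬ LiouvilleConjectureNS :=
  fun hL => h (mustSqueeze_of_liouvilleConjectureNS hL)

/-- **Refutation criterion** (what a future adversary must exhibit): `¬ MustSqueeze` iff some
`C` and some member of `𝒦_C`, squeezed everywhere (`Λ ≤ 1/8`), is nonzero at one point of the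
past; necessarily `C > 0` (`vanishes_of_h4_nonpos`) and the member is a Type-I KNSS-mild field
(`Theorems.isTypeIAncientMild_of_squeezeClass`). -/
theorem not_mustSqueeze_iff :
    ¬ MustSqueeze ↔ ∃ (C : ℝ) (u : ℝ → ℝ³ → ℝ³), InClass C u ∧ H6 (1 / 8) u ∧ 0 < C ∧
      IsTypeIAncientMild C u ∧ ∃ t : ℝ, t < 0 ∧ ∃ x : ℝ³, u t x ≠ 0 := by
  constructor
  · intro h
    rw [mustSqueeze_iff] at h
    push Not at h
    obtain ⟨C, u, hu, h6, hne⟩ := h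
    have hne' : ∃ t : ℝ, t < 0 ∧ ∃ x : ℝ³, u t x ≠ 0 := by
      by_contra hcon
      push Not at hcon
      exact hne hcon
    refine ⟨C, u, hu, h6, ?_, ?_, hne'⟩
    · by_contra hC
      obtain ⟨t, ht, x, hx⟩ := hne'
      exact hx (vanishes_of_h4_nonpos (not_lt.1 hC) hu.2.2.2.1 t ht x)
    · exact Theorems.isTypeIAncientMild_of_squeezeClass hu.1 hu.2.1 hu.2.2.1 hu.2.2.2.1
  · rintro ⟨C, u, hu, h6, -, -, t, ht, x, hx⟩ h
    exact hx (h C u hu h6 t ht x)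

/-! ## §7 The threshold family `MustSqueezeAt a` -/

/-- The crux with threshold `a` in place of `1/8`. -/
def MustSqueezeAt (a : ℝ) : Prop :=
  ∀ (C : ℝ) (u : ℝ → ℝ³ → ℝ³), InClass C u → H6 a u → VanishesOnPast u

theorem mustSqueeze_iff_mustSqueezeAt : MustSqueeze ↔ MustSqueezeAt (1 / 8) := Iff.rfl

/-- H6 is monotone in the threshold. -/
theorem h6_mono {a b : ℝ} (hab : a ≤ b) {u : ℝ → ℝ³ → ℝ³} (h : H6 a u) : H6 b u := by
  intro t ht x
  obtain ⟨v, w, hv, hw, hvw, hq⟩ := h t ht x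
  exact ⟨v, w, hv, hw, hvw, fun α β => (hq α β).trans (by nlinarith [sq_nonneg α, sq_nonneg β])⟩

/-- `MustSqueezeAt` is antitone: a larger threshold is a STRONGER statement.  With
`no_leray_rate_of_subquarter` / `production_const_sharp` the natural conjecture is
`MustSqueezeAt a` for every `a < 1/4`; the route only needs `a = 1/8`. -/
theorem mustSqueezeAt_antitone {a b : ℝ} (hab : a ≤ b) (h : MustSqueezeAt b) : MustSqueezeAt a :=
  fun C u hu h6 => h C u hu (h6_mono hab h6)

/-- The full Liouville statement on `𝒦_C` gives every threshold. (The converse, "all thresholds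
⇒ `SqueezeLiouville`", needs the KNSS gauge gradient bound `(−t)|∇u| ≤ C₁(C)` on the class,
which is not in the tree.) -/
theorem mustSqueezeAt_of_squeezeLiouville (hL : SqueezeLiouville) (a : ℝ) : MustSqueezeAt a :=
  fun C u hu _ => hL C u hu

/-- **Forward time shifts improve the squeeze.** For `δ ≥ 0` and `a ≥ 0`, if `u` is squeezed
(`H6 a`) then so is `t ↦ u (t − δ)`: at time `t` the gauge weight drops from `δ − t` to `−t`
on the non-negative part of the form and only helps on the negative part.  (All other clauses
of `𝒦_C` are invariant under `t ↦ t − δ` as well — `IsTypeIAncientMild.comp_sub_right` and, for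
H5, re-indexing the cylinder tops `t₀ ↦ t₀ − δ ≤ 0`; so the counterexample set is closed under
forward time shifts, none of which can create a squeeze.) -/
theorem h6_comp_sub {a δ : ℝ} (ha : 0 ≤ a) (hδ : 0 ≤ δ) {u : ℝ → ℝ³ → ℝ³} (h : H6 a u) :
    H6 a (fun t => u (t - δ)) := by
  intro t ht x
  obtain ⟨v, w, hv, hw, hvw, hq⟩ := h (t - δ) (by linarith) x
  refine ⟨v, w, hv, hw, hvw, fun α β => ?_⟩
  have hq' := hq α β
  set Q : ℝ := inner ℝ (fderiv ℝ (u (t - δ)) x (α • v + β • w)) (α • v + β • w) with hQ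
  have hab : 0 ≤ a * (α ^ 2 + β ^ 2) := by positivity
  show -t * Q ≤ a * (α ^ 2 + β ^ 2)
  have h1 : -(t - δ) * Q ≤ a * (α ^ 2 + β ^ 2) := hq'
  rcases le_or_gt 0 Q with hQ0 | hQ0
  · calc -t * Q ≤ -(t - δ) * Q := by nlinarith
      _ ≤ a * (α ^ 2 + β ^ 2) := h1
  · calc -t * Q ≤ 0 := by nlinarith
      _ ≤ a * (α ^ 2 + β ^ 2) := hab

/-! ## §8 Targets — lead skeleton v1 (`Lines/outward-drift-signed-flux.lean`), the abstract
two-pass Grönwall stub: which hypotheses carry it -/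

namespace Targets

/-- The statement of `stub_twoPassGronwall` (lead skeleton v1, `Lines/outward-drift-signed-flux.lean`),
verbatim (the `Lines/` file is not an importable module, so it is restated; `Iff.rfl` against
the stub's type).  It is TRUE (two backward-Grönwall passes with `L¹_unif` forcing, the tree's
`Theorems.backward_gronwall_bound`; drefute evidence `finiteEnstrophy_abstract` = pass 1), and the
three theorems below show which hypotheses carry it.  NEVER USED by the two-pass argument, hence
removable (information for the lead — each removal also simplifies an upstream stub):
(i) `0 ≤ Z R s` (good times come from the unit averages `∫Z R ≤ 6∫E(2R) ≤ 12BR` whatever the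
sign; the final step bounds `∫E R ≤ ∫Z R + |κ'|√(K₂/R)` from above only);
(ii) `Z R s ≤ Z R' s` for `R ≤ R'` (conclusion (d) of `stub_divCurlBalls`): monotonicity of `E`
in `ρ` alone carries the limit `R → ∞`, since `∫_s^{s+1} E ρ ≤ ∫_s^{s+1} E R` for `ρ ≤ R`;
(iii) continuity of `K` (in `stub_signedBudget` too): only `deriv (Z R) ≤ −cZ R + g` with the
CONTINUOUS majorant `g = κ⁺(E(2R)/R + √(E(2R)/R))` is integrated. -/
def TwoPassGronwall : Prop :=
  ∀ (c κ κ' B : ℝ) (Z E : ℝ → ℝ → ℝ), 0 < c →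
    (∀ (ρ s : ℝ), 0 < ρ → 0 ≤ E ρ s) →
    (∀ ρ : ℝ, 0 < ρ → Continuous (E ρ)) →
    (∀ (s ρ ρ' : ℝ), 0 < ρ → ρ ≤ ρ' → E ρ s ≤ E ρ' s) →
    (∀ (s ρ : ℝ), 1 ≤ ρ → ∫ σ in s..(s + 1), E ρ σ ≤ B * ρ) →
    (∀ R : ℝ, 1 ≤ R → Differentiable ℝ (Z R) ∧ ∃ K : ℝ → ℝ, Continuous K ∧ (∀ s, 0 ≤ K s) ∧
      (∀ s, K s ≤ κ * (E (2 * R) s / R + Real.sqrt (E (2 * R) s / R))) ∧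
      ∀ s, deriv (Z R) s ≤ -c * Z R s + K s) →
    (∀ (R s : ℝ), 1 ≤ R → 0 ≤ Z R s) →
    (∀ (R R' s : ℝ), 1 ≤ R → R ≤ R' → Z R s ≤ Z R' s) →
    (∀ (R s : ℝ), 1 ≤ R → Z R s ≤ 6 * E (2 * R) s) →
    (∀ (R s : ℝ), 1 ≤ R → E R s ≤ Z R s + κ' * Real.sqrt (E (2 * R) s / R)) →
    ∀ (ρ s : ℝ), 0 < ρ → E ρ s = 0

/-- `stub_twoPassGronwall` with the good-times comparison `Z R ≤ 6 E(2R)` DELETED. -/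
def TwoPassGronwallWithoutGoodTimes : Prop :=
  ∀ (c κ κ' B : ℝ) (Z E : ℝ → ℝ → ℝ), 0 < c →
    (∀ (ρ s : ℝ), 0 < ρ → 0 ≤ E ρ s) →
    (∀ ρ : ℝ, 0 < ρ → Continuous (E ρ)) →
    (∀ (s ρ ρ' : ℝ), 0 < ρ → ρ ≤ ρ' → E ρ s ≤ E ρ' s) →
    (∀ (s ρ : ℝ), 1 ≤ ρ → ∫ σ in s..(s + 1), E ρ σ ≤ B * ρ) →
    (∀ R : ℝ, 1 ≤ R → Differentiable ℝ (Z R) ∧ ∃ K : ℝ → ℝ, Continuous K ∧ (∀ s, 0 ≤ K s) ∧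
      (∀ s, K s ≤ κ * (E (2 * R) s / R + Real.sqrt (E (2 * R) s / R))) ∧
      ∀ s, deriv (Z R) s ≤ -c * Z R s + K s) →
    (∀ (R s : ℝ), 1 ≤ R → 0 ≤ Z R s) →
    (∀ (R R' s : ℝ), 1 ≤ R → R ≤ R' → Z R s ≤ Z R' s) →
    (∀ (R s : ℝ), 1 ≤ R → E R s ≤ Z R s + κ' * Real.sqrt (E (2 * R) s / R)) →
    ∀ (ρ s : ℝ), 0 < ρ → E ρ s = 0

/-- `stub_twoPassGronwall` with the time-averaged bound `∫_s^{s+1} E ρ ≤ Bρ` DELETED. -/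
def TwoPassGronwallWithoutTimeAverage : Prop :=
  ∀ (c κ κ' : ℝ) (Z E : ℝ → ℝ → ℝ), 0 < c →
    (∀ (ρ s : ℝ), 0 < ρ → 0 ≤ E ρ s) →
    (∀ ρ : ℝ, 0 < ρ → Continuous (E ρ)) →
    (∀ (s ρ ρ' : ℝ), 0 < ρ → ρ ≤ ρ' → E ρ s ≤ E ρ' s) →
    (∀ R : ℝ, 1 ≤ R → Differentiable ℝ (Z R) ∧ ∃ K : ℝ → ℝ, Continuous K ∧ (∀ s, 0 ≤ K s) ∧
      (∀ s, K s ≤ κ * (E (2 * R) s / R + Real.sqrt (E (2 * R) s / R))) ∧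
      ∀ s, deriv (Z R) s ≤ -c * Z R s + K s) →
    (∀ (R s : ℝ), 1 ≤ R → 0 ≤ Z R s) →
    (∀ (R R' s : ℝ), 1 ≤ R → R ≤ R' → Z R s ≤ Z R' s) →
    (∀ (R s : ℝ), 1 ≤ R → Z R s ≤ 6 * E (2 * R) s) →
    (∀ (R s : ℝ), 1 ≤ R → E R s ≤ Z R s + κ' * Real.sqrt (E (2 * R) s / R)) →
    ∀ (ρ s : ℝ), 0 < ρ → E ρ s = 0

/-- `stub_twoPassGronwall` with the comparison `E R ≤ Z R + κ'√(E(2R)/R)` DELETED. -/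
def TwoPassGronwallWithoutComparison : Prop :=
  ∀ (c κ B : ℝ) (Z E : ℝ → ℝ → ℝ), 0 < c →
    (∀ (ρ s : ℝ), 0 < ρ → 0 ≤ E ρ s) →
    (∀ ρ : ℝ, 0 < ρ → Continuous (E ρ)) →
    (∀ (s ρ ρ' : ℝ), 0 < ρ → ρ ≤ ρ' → E ρ s ≤ E ρ' s) →
    (∀ (s ρ : ℝ), 1 ≤ ρ → ∫ σ in s..(s + 1), E ρ σ ≤ B * ρ) →
    (∀ R : ℝ, 1 ≤ R → Differentiable ℝ (Z R) ∧ ∃ K : ℝ → ℝ, Continuous K ∧ (∀ s, 0 ≤ K s) ∧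
      (∀ s, K s ≤ κ * (E (2 * R) s / R + Real.sqrt (E (2 * R) s / R))) ∧
      ∀ s, deriv (Z R) s ≤ -c * Z R s + K s) →
    (∀ (R s : ℝ), 1 ≤ R → 0 ≤ Z R s) →
    (∀ (R R' s : ℝ), 1 ≤ R → R ≤ R' → Z R s ≤ Z R' s) →
    (∀ (R s : ℝ), 1 ≤ R → Z R s ≤ 6 * E (2 * R) s) →
    ∀ (ρ s : ℝ), 0 < ρ → E ρ s = 0

/-- The backward exponential `e^{−s}`: derivative and the damped law with `c = 1`, `K = 0`. -/
theorem hasDerivAt_exp_neg (s : ℝ) : HasDerivAt (fun s => Real.exp (-s)) (-Real.exp (-s)) s := by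
  simpa using (hasDerivAt_neg s).exp

/-- `(e^{−s})' = −e^{−s}`. -/
theorem deriv_exp_neg (s : ℝ) : deriv (fun s => Real.exp (-s)) s = -Real.exp (-s) :=
  (hasDerivAt_exp_neg s).deriv

/-- `s ↦ e^{−s}` is differentiable. -/
theorem differentiable_exp_neg : Differentiable ℝ (fun s : ℝ => Real.exp (-s)) :=
  fun s => (hasDerivAt_exp_neg s).differentiableAt

/-- The zero forcing satisfies the budget clause for `Z R = e^{−s}`, `c = 1`, `κ = 0`. -/
theorem budget_exp_neg (E : ℝ → ℝ → ℝ) (R : ℝ) :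
    Differentiable ℝ (fun s : ℝ => Real.exp (-s)) ∧ ∃ K : ℝ → ℝ, Continuous K ∧ (∀ s, 0 ≤ K s) ∧
      (∀ s, K s ≤ 0 * (E (2 * R) s / R + Real.sqrt (E (2 * R) s / R))) ∧
      ∀ s, deriv (fun s : ℝ => Real.exp (-s)) s ≤ -1 * Real.exp (-s) + K s := by
  refine ⟨differentiable_exp_neg, fun _ => 0, continuous_const, fun _ => le_rfl, fun s => by simp,
    fun s => ?_⟩
  rw [deriv_exp_neg]; simp

/-- Unit-time integral of a function bounded by `1`. -/
theorem intervalIntegral_le_one_of_le_one {f : ℝ → ℝ} (hf : Continuous f) (h1 : ∀ σ, f σ ≤ 1)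
    (s : ℝ) : ∫ σ in s..(s + 1), f σ ≤ 1 := by
  have h : ∫ σ in s..(s + 1), f σ ≤ ∫ σ in s..(s + 1), (1 : ℝ) :=
    intervalIntegral.integral_mono_on (by linarith) (hf.intervalIntegrable _ _)
      (continuous_const.intervalIntegrable _ _) (fun σ _ => h1 σ)
  simpa using h

/-- **Good times are load-bearing.**  Without `Z R ≤ 6E(2R)` (the only clause tying `Z` to a
time-averaged quantity, i.e. the source of the "good times" of pass 1) the abstract stub is
FALSE: `Z R s = e^{−s}` (backward-exponentially growing, exactly the mode ancient Grönwall must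
exclude), `E ρ s = min(1, e^{−s})`, `c = 1`, `κ = κ' = 0`, `B = 1`. -/
theorem twoPassGronwall_false_without_goodTimes : ¬ TwoPassGronwallWithoutGoodTimes := by
  intro h
  have hEc : Continuous fun s : ℝ => min (1 : ℝ) (Real.exp (-s)) :=
    continuous_const.min (Real.continuous_exp.comp continuous_neg)
  have key := h 1 0 0 1 (fun _ s => Real.exp (-s)) (fun _ s => min 1 (Real.exp (-s))) one_pos
    (fun _ s _ => le_min zero_le_one (Real.exp_pos _).le)
    (fun _ _ => hEc)
    (fun _ _ _ _ _ => le_rfl)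
    (fun s ρ hρ => (intervalIntegral_le_one_of_le_one hEc (fun σ => min_le_left _ _) s).trans
      (by linarith))
    (fun R _ => budget_exp_neg (fun _ s => min 1 (Real.exp (-s))) R)
    (fun _ s _ => (Real.exp_pos _).le)
    (fun _ _ _ _ _ => le_rfl)
    (fun R s _ => by simp)
    1 0 one_pos
  norm_num at key

/-- **The time-averaged bound (H5b) is load-bearing.**  Without `∫_s^{s+1} E ρ ≤ Bρ` the stub
is FALSE: `Z R s = E ρ s = e^{−s}` satisfies every remaining clause (`c = 1`, `κ = κ' = 0`). -/
theorem twoPassGronwall_false_without_timeAverage : ¬ TwoPassGronwallWithoutTimeAverage := by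
  intro h
  have hEc : Continuous fun s : ℝ => Real.exp (-s) := Real.continuous_exp.comp continuous_neg
  have key := h 1 0 0 (fun _ s => Real.exp (-s)) (fun _ s => Real.exp (-s)) one_pos
    (fun _ s _ => (Real.exp_pos _).le)
    (fun _ _ => hEc)
    (fun _ _ _ _ _ => le_rfl)
    (fun R _ => budget_exp_neg (fun _ s => Real.exp (-s)) R)
    (fun _ s _ => (Real.exp_pos _).le)
    (fun _ _ _ _ _ => le_rfl)
    (fun R s _ => by nlinarith [Real.exp_pos (-s)])
    (fun R s _ => by simp)
    1 0 one_pos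
  norm_num at key

/-- **The div–curl comparison is load-bearing.**  Without `E R ≤ Z R + κ'√(E(2R)/R)` nothing
ties `E` back to `Z`: `Z ≡ 0`, `E ≡ 1`, `c = 1`, `κ = 0`, `B = 1`. -/
theorem twoPassGronwall_false_without_comparison : ¬ TwoPassGronwallWithoutComparison := by
  intro h
  have key := h 1 0 1 (fun _ _ => 0) (fun _ _ => 1) one_pos
    (fun _ _ _ => zero_le_one)
    (fun _ _ => continuous_const)
    (fun _ _ _ _ _ => le_rfl)
    (fun s ρ hρ => by simp; linarith)
    (fun R _ => ⟨differentiable_const _, fun _ => 0, continuous_const, fun _ => le_rfl,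
      fun s => by simp, fun s => by simp⟩)
    (fun _ _ _ => le_rfl)
    (fun _ _ _ _ _ => le_rfl)
    (fun R s _ => by norm_num)
    1 0 one_pos
  norm_num at key

end Targets


/-! ## §9 Negative thresholds: below `a = 0` the sharp Miller constant is `4/3`, not `2`
(the lever's hypothesis `0 ≤ a`, at the level of the pointwise algebra) -/

/-- **The `4/3`-law for a non-positive middle eigenvalue.** For an ordered trace-free triple
`λ₁ ≥ λ₂ ≥ λ₃` with `λ₂ ≤ 0`: `−4λ₁λ₂λ₃ ≤ (4/3)·λ₂·(λ₁² + λ₂² + λ₃²)`.  (Exact remainder: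
`RHS − LHS = (4/3)·λ₂(2λ₂ + λ₃)(λ₂ − λ₃) ≥ 0`.)  So once the squeeze pushes `λ₂` BELOW zero
the local production is not merely `≤ 0` (which is all that `production_le_two_middle` gives,
its right-hand side being `2λ₂⁺|S|² = 0`) but negative, of size `(4/3)|λ₂||S|²`. -/
theorem production_le_fourThirds_middle_of_nonpos (l₁ l₂ l₃ : ℝ) (h12 : l₂ ≤ l₁) (h23 : l₃ ≤ l₂)
    (htr : l₁ + l₂ + l₃ = 0) (h2 : l₂ ≤ 0) :
    -4 * (l₁ * l₂ * l₃) ≤ (4 / 3) * l₂ * (l₁ ^ 2 + l₂ ^ 2 + l₃ ^ 2) := by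
  have h1 : l₁ = -(l₂ + l₃) := by linarith
  subst h1
  have key : 0 ≤ (-l₂) * (-(2 * l₂ + l₃)) * (l₂ - l₃) :=
    mul_nonneg (mul_nonneg (by linarith) (by linarith)) (by linarith)
  nlinarith [key]

/-- Hence, under a NEGATIVE threshold `λ₂ ≤ a ≤ 0`: `−4 det S ≤ (4/3)·a·|S|²`. -/
theorem production_le_fourThirds_of_middle_le {a : ℝ} (ha : a ≤ 0) (l₁ l₂ l₃ : ℝ) (h12 : l₂ ≤ l₁)
    (h23 : l₃ ≤ l₂) (htr : l₁ + l₂ + l₃ = 0) (h2a : l₂ ≤ a) :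
    -4 * (l₁ * l₂ * l₃) ≤ (4 / 3) * a * (l₁ ^ 2 + l₂ ^ 2 + l₃ ^ 2) := by
  have h := production_le_fourThirds_middle_of_nonpos l₁ l₂ l₃ h12 h23 htr (h2a.trans ha)
  have hS : 0 ≤ l₁ ^ 2 + l₂ ^ 2 + l₃ ^ 2 := by positivity
  nlinarith [mul_le_mul_of_nonneg_right h2a hS]

/-- **`4/3` is attained** at the axisymmetric-compression triple `(−2a, a, a)` (two equal
compressive eigenvalues — the strain of a Burgers-vortex core, `λ = (α, −α/2, −α/2)`), for every
`a`: equality in `production_le_fourThirds_middle_of_nonpos`. -/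
theorem production_fourThirds_attained (a : ℝ) :
    -4 * ((-2 * a) * a * a) = (4 / 3) * a * ((-2 * a) ^ 2 + a ^ 2 + a ^ 2) := by
  ring

/-- **The constant-`2` form is FALSE for negative thresholds.** For every `a < 0` the ordered
trace-free triple `(−2a, a, a)` has `λ₂ = a`, yet `−4λ₁λ₂λ₃ = 8a³ > 12a³ = 2a|S|²`.  So the
bound "`λ₂ ≤ a ⇒ −4 det S ≤ 2a|S|²`" — which is what the lever's budget
`Z' ≤ −2(¼ − a)Z + K` would need pointwise for `a < 0` — fails; the honest damping below zero is
`2(¼ − (2/3)a)`, from the `4/3`-law.  This is the algebraic content of the hypothesis `0 ≤ a` in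
`stub_signedBudget` (harmless for the crux, `a = 1/8`; and `MustSqueezeAt a` for `a < 0` is
anyway WEAKER than `MustSqueezeAt 0`, `mustSqueezeAt_antitone`). -/
theorem not_production_le_two_middle_of_neg {a : ℝ} (ha : a < 0) :
    a ≤ -2 * a ∧ a ≤ a ∧ (-2 * a) + a + a = 0 ∧
      ¬ (-4 * ((-2 * a) * a * a) ≤ 2 * a * ((-2 * a) ^ 2 + a ^ 2 + a ^ 2)) := by
  refine ⟨by linarith, le_rfl, by ring, fun h => ?_⟩
  have h3 : a * (a * a) < 0 := mul_neg_of_neg_of_pos ha (mul_pos_of_neg_of_neg ha ha)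
  nlinarith [h3]

/-- The two regimes side by side: the sharp pointwise constant `c(a)` in
"`λ₂ ≤ a ⇒ −4 det S ≤ c(a)·a·|S|²`" is `2` for `a ≥ 0` (`production_le_two_middle`,
`production_const_sharp`) and `4/3` for `a ≤ 0` (this section); both vanish continuously at
`a = 0`, where the squeeze yields exactly Leray's free damping `¼` and nothing more. -/
theorem production_le_of_middle_le (a l₁ l₂ l₃ : ℝ) (h12 : l₂ ≤ l₁) (h23 : l₃ ≤ l₂)
    (htr : l₁ + l₂ + l₃ = 0) (h2a : l₂ ≤ a) :
    -4 * (l₁ * l₂ * l₃) ≤ max (2 * a) ((4 / 3) * a) * (l₁ ^ 2 + l₂ ^ 2 + l₃ ^ 2) := by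
  have hS : 0 ≤ l₁ ^ 2 + l₂ ^ 2 + l₃ ^ 2 := by positivity
  rcases le_or_gt a 0 with ha | ha
  · have h := production_le_fourThirds_of_middle_le ha l₁ l₂ l₃ h12 h23 htr h2a
    exact h.trans (mul_le_mul_of_nonneg_right (le_max_right _ _) hS)
  · rcases le_or_gt 0 l₂ with h2 | h2
    · have h3 : l₃ = -(l₁ + l₂) := by linarith
      subst h3
      have h1 : 0 ≤ l₁ := le_trans h2 h12
      have hS' : 0 ≤ l₁ ^ 2 + l₂ ^ 2 + (-(l₁ + l₂)) ^ 2 := by positivity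
      have hmain : -4 * (l₁ * l₂ * -(l₁ + l₂)) ≤ 2 * l₂ * (l₁ ^ 2 + l₂ ^ 2 + (-(l₁ + l₂)) ^ 2) := by
        nlinarith [mul_nonneg h1 h2, mul_nonneg (mul_nonneg h1 h2) h1, mul_nonneg (mul_nonneg h1 h2) h2]
      calc -4 * (l₁ * l₂ * -(l₁ + l₂)) ≤ 2 * l₂ * (l₁ ^ 2 + l₂ ^ 2 + (-(l₁ + l₂)) ^ 2) := hmain
        _ ≤ 2 * a * (l₁ ^ 2 + l₂ ^ 2 + (-(l₁ + l₂)) ^ 2) := by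
          nlinarith [mul_le_mul_of_nonneg_right h2a hS']
        _ ≤ max (2 * a) ((4 / 3) * a) * (l₁ ^ 2 + l₂ ^ 2 + (-(l₁ + l₂)) ^ 2) :=
          mul_le_mul_of_nonneg_right (le_max_left _ _) hS'
    · have h := production_le_fourThirds_middle_of_nonpos l₁ l₂ l₃ h12 h23 htr h2.le
      have h4 : (4 / 3) * l₂ * (l₁ ^ 2 + l₂ ^ 2 + l₃ ^ 2) ≤ 0 := by
        have : (4 / 3) * l₂ ≤ 0 := by linarith
        exact mul_nonpos_of_nonpos_of_nonneg this hS
      have h5 : 0 ≤ max (2 * a) ((4 / 3) * a) * (l₁ ^ 2 + l₂ ^ 2 + l₃ ^ 2) :=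
        mul_nonneg (le_max_of_le_left (by linarith)) hS
      linarith

/-! ## §10 Targets (ctd.): the abstract engine dies exactly at zero damping (`a = 1/4`) -/

namespace Targets

/-- `stub_twoPassGronwall` with the strict damping `0 < c` weakened to `0 ≤ c` — i.e. the
abstract two-pass engine run AT the quarter, `c = 2(¼ − a) = 0`. -/
def TwoPassGronwallNonnegDamping : Prop :=
  ∀ (c κ κ' B : ℝ) (Z E : ℝ → ℝ → ℝ), 0 ≤ c →
    (∀ (ρ s : ℝ), 0 < ρ → 0 ≤ E ρ s) →
    (∀ ρ : ℝ, 0 < ρ → Continuous (E ρ)) →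
    (∀ (s ρ ρ' : ℝ), 0 < ρ → ρ ≤ ρ' → E ρ s ≤ E ρ' s) →
    (∀ (s ρ : ℝ), 1 ≤ ρ → ∫ σ in s..(s + 1), E ρ σ ≤ B * ρ) →
    (∀ R : ℝ, 1 ≤ R → Differentiable ℝ (Z R) ∧ ∃ K : ℝ → ℝ, Continuous K ∧ (∀ s, 0 ≤ K s) ∧
      (∀ s, K s ≤ κ * (E (2 * R) s / R + Real.sqrt (E (2 * R) s / R))) ∧
      ∀ s, deriv (Z R) s ≤ -c * Z R s + K s) →
    (∀ (R s : ℝ), 1 ≤ R → 0 ≤ Z R s) →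
    (∀ (R R' s : ℝ), 1 ≤ R → R ≤ R' → Z R s ≤ Z R' s) →
    (∀ (R s : ℝ), 1 ≤ R → Z R s ≤ 6 * E (2 * R) s) →
    (∀ (R s : ℝ), 1 ≤ R → E R s ≤ Z R s + κ' * Real.sqrt (E (2 * R) s / R)) →
    ∀ (ρ s : ℝ), 0 < ρ → E ρ s = 0

/-- **Zero damping is fatal** (tightness of `0 < c`, i.e. of `a < 1/4`, inside the lead's own
stub): with `0 ≤ c` the abstract stub is FALSE — the frozen state `Z ≡ E ≡ 1`, `K ≡ 0`,
`c = κ = κ' = 0`, `B = 1` satisfies every clause (all comparisons with room) and `E ≠ 0`.  This is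
the abstract shadow of `quarter_rate_saturates`: at the quarter the similarity enstrophy may sit
at a nonzero constant forever, which is Leray's exact rate `‖ω‖² ∼ (T−t)^{−1/2}`. -/
theorem twoPassGronwall_false_at_zero_damping : ¬ TwoPassGronwallNonnegDamping := by
  intro h
  have key := h 0 0 0 1 (fun _ _ => 1) (fun _ _ => 1) le_rfl
    (fun _ _ _ => zero_le_one)
    (fun _ _ => continuous_const)
    (fun _ _ _ _ _ => le_rfl)
    (fun s ρ hρ => by simp; linarith)
    (fun R _ => ⟨differentiable_const _, fun _ => 0, continuous_const, fun _ => le_rfl,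
      fun s => by simp, fun s => by simp⟩)
    (fun _ _ _ => zero_le_one)
    (fun _ _ _ _ _ => le_rfl)
    (fun R s _ => by norm_num)
    (fun R s _ => by simp)
    1 0 one_pos
  norm_num at key

end Targets

/-! ## §11 Linear Leray profiles: exact squeezed self-similar Navier–Stokes flows outside `𝒦_C`

The two-parameter linear field `linA μ b y = (−μy₀ + b y₁, −b y₀ − μ y₁, 2μ y₂)` (axisymmetric
strain `diag(−μ, −μ, 2μ)` plus rotation of rate `b` about the axis `e₂`) is an EXACT profile of
Leray's backward self-similar system `−νΔU + ½U + ½(y·∇)U + (U·∇)U + ∇P = 0`, `div U = 0`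
(tree `IsLerayProfile ν (1/2)`), for every viscosity `ν` (it is harmonic), exactly when
`b(1 − 2μ) = 0`: the pure strains (`b = 0`, any `μ`) and the **stretched similarity column**
(`μ = ½`, any swirl `b`), whose similarity vorticity `curl U = −2b e₂` is STATIONARY — stretching
`(Ω·∇)U = Ω` exactly balances Leray's damping.  The physical field is Leray's ansatz
`u(t,x) = (−t)⁻¹ linA μ b x`, an exact ancient Navier–Stokes flow, smooth and divergence free on
`t < 0` (H1, H2), squeezed with `Λ ≡ −μ` — ANY real threshold (`lin_h6`) — and not Type-I bounded
(`lin_not_h4`; it also violates H5 and the typed Oseen clause H3: pressure-driven from infinity).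

Consequences: (i) `not_mustSqueezeProfiles` — the self-similar shadow of the crux WITHOUT
normalisation ("every Leray profile squeezed below `a` vanishes") is false for every `a : ℝ`; in the
self-similar sector the squeeze has no force of its own (NRŠ 1996 / Tsai 1998 kill profiles through
`L³` / local energy, i.e. H4–H5, whatever `Λ` is).  (ii) For the picked line: on the column
`Z_R(s) = ∫φ_R|Ω|² = 4b²∫φ_R` is a nonzero constant in `s` although `λ₂ = −½ < 0`; the lever's budget
`Z_R' ≤ −2(¼ − a)Z_R + K_R`, `K_R ≤ κ(E(2R)/R + √(E(2R)/R))`, would be violated for large `R`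
(`Z_R ∼ R³` against `E(2R)/R ∼ R²`): what fails is `‖U‖_∞ ≤ C` — the transport flux
`½∫|Ω|²(U·∇φ_R)` and the cubic flux are of leading order `R³` when `|U| ∼ R`.  So the dependence of
`κ` on `C = ‖U‖_∞` (H4 in similarity variables) is exactly where the normalisation enters the lever;
production here is `Ω·SΩ = +|Ω|²` (all from `λ₁ = 1 ∥ Ω`), the dynamic `not_pointwise_surrogate`.
In print: the family is the self-similar member of Majda–Bertozzi's exact linear flows
`v = ½ω(t)×x + 𝒟(t)x`, `ω̇ = 𝒟ω` (Vorticity and Incompressible Flow, 2002, Prop. 1.5, (1.23)–(1.24),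
p. 8), with `𝒟(t) = diag(−μ,−μ,2μ)/(−t)`: the ODE gives `ω₃ ∝ (−t)^{−2μ}`, self-similar iff `μ = ½`.
Module form (proposed p73275): `Theorems/MustSqueeze/Negative/LinearLerayProfiles.lean`. -/

section LinearProfiles

open scoped RealInnerProductSpace Laplacian

/-- `e₂`, the stretching axis. -/
def e2 : ℝ³ := EuclideanSpace.single 2 1

/-- The linear profile `linA μ b y = (−μy₀ + b y₁, −b y₀ − μ y₁, 2μ y₂)`. -/
def linA (μ b : ℝ) : ℝ³ →L[ℝ] ℝ³ :=
  (-μ) • ((EuclideanSpace.proj (0 : Fin 3) : ℝ³ →L[ℝ] ℝ).smulRight e0 +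
      (EuclideanSpace.proj (1 : Fin 3) : ℝ³ →L[ℝ] ℝ).smulRight e1) +
    (2 * μ) • (EuclideanSpace.proj (2 : Fin 3) : ℝ³ →L[ℝ] ℝ).smulRight e2 - b • rot

theorem linA_apply (μ b : ℝ) (y : ℝ³) :
    linA μ b y = (-μ) • (y 0 • e0 + y 1 • e1) + (2 * μ) • (y 2 • e2) - b • rot y := rfl

theorem linA_fst (μ b : ℝ) (y : ℝ³) : linA μ b y 0 = -μ * y 0 + b * y 1 := by
  have h := rot_coord y
  simp [linA_apply, e0, e1, e2, h.1]

theorem linA_snd (μ b : ℝ) (y : ℝ³) : linA μ b y 1 = -b * y 0 - μ * y 1 := by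
  have h := rot_coord y
  simp [linA_apply, e0, e1, e2, h.2.1]
  ring

theorem linA_thd (μ b : ℝ) (y : ℝ³) : linA μ b y 2 = 2 * μ * y 2 := by
  have h := rot_coord y
  simp [linA_apply, e0, e1, e2, h.2.2]

/-- The linear profile is divergence free (`tr = −μ − μ + 2μ = 0`). -/
theorem linA_divFree (μ b : ℝ) : VectorCalculus.IsDivFree (⇑(linA μ b)) := by
  intro y
  rw [divergence_eq_sum_inner_fderiv (EuclideanSpace.basisFun (Fin 3) ℝ), (linA μ b).fderiv,
    Fin.sum_univ_three]
  simp only [EuclideanSpace.basisFun_apply, EuclideanSpace.inner_single_left, map_one, one_mul,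
    linA_fst, linA_snd, linA_thd]
  simp
  ring

/-- Its vorticity is the constant vector `−2b e₂` (pure swirl about the axis). -/
theorem curl_linA (μ b : ℝ) (y : ℝ³) : curl (⇑(linA μ b)) y = (-2 * b) • e2 := by
  have hD : fderiv ℝ (⇑(linA μ b)) y = linA μ b := (linA μ b).fderiv
  ext i
  fin_cases i
  · simp [curl, hD, linA_fst, linA_snd, linA_thd, e2]
  · simp [curl, hD, linA_fst, linA_snd, linA_thd, e2]
  · simp [curl, hD, linA_fst, linA_snd, linA_thd, e2]
    ring

/-- The axis is an eigenvector with eigenvalue `2μ`: `(Ω·∇)U = 2μ Ω` for `Ω ∥ e₂`. -/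
theorem linA_e2 (μ b : ℝ) : linA μ b e2 = (2 * μ) • e2 := by
  ext i
  fin_cases i
  · simp [linA_fst, e2]
  · simp [linA_snd, e2]
  · simp [linA_thd, e2]

/-- The quadratic form on the plane `e₀, e₁` is `−μ|ξ|²` (the squeezed plane; `λ₂(sym) = −μ`
for `μ ≥ −2μ`, i.e. `μ ≥ 0`, and in any case the Courant–Fischer clause H6 holds with `a = −μ`). -/
theorem inner_linA_plane (μ b α β : ℝ) :
    ⟪linA μ b (α • e0 + β • e1), α • e0 + β • e1⟫ = -μ * (α ^ 2 + β ^ 2) := by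
  rw [real_inner_fin_three, linA_fst, linA_snd, linA_thd]
  simp [e0, e1]
  ring

/-! ### The pressure and Leray's profile system -/

/-- The (diagonal) pressure Hessian `−∇²P = diag(μ² − μ − b², μ² − μ − b², 2μ + 4μ²)`. -/
def linQ (μ b : ℝ) : ℝ³ →L[ℝ] ℝ³ :=
  (μ ^ 2 - μ - b ^ 2) • ((EuclideanSpace.proj (0 : Fin 3) : ℝ³ →L[ℝ] ℝ).smulRight e0 +
      (EuclideanSpace.proj (1 : Fin 3) : ℝ³ →L[ℝ] ℝ).smulRight e1) +
    (2 * μ + 4 * μ ^ 2) • (EuclideanSpace.proj (2 : Fin 3) : ℝ³ →L[ℝ] ℝ).smulRight e2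

theorem linQ_apply (μ b : ℝ) (y : ℝ³) :
    linQ μ b y = (μ ^ 2 - μ - b ^ 2) • (y 0 • e0 + y 1 • e1) + (2 * μ + 4 * μ ^ 2) • (y 2 • e2) := rfl

theorem linQ_fst (μ b : ℝ) (y : ℝ³) : linQ μ b y 0 = (μ ^ 2 - μ - b ^ 2) * y 0 := by
  simp [linQ_apply, e0, e1, e2]

theorem linQ_snd (μ b : ℝ) (y : ℝ³) : linQ μ b y 1 = (μ ^ 2 - μ - b ^ 2) * y 1 := by
  simp [linQ_apply, e0, e1, e2]

theorem linQ_thd (μ b : ℝ) (y : ℝ³) : linQ μ b y 2 = (2 * μ + 4 * μ ^ 2) * y 2 := by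
  simp [linQ_apply, e0, e1, e2]

theorem linQ_symm (μ b : ℝ) (x y : ℝ³) : ⟪linQ μ b x, y⟫ = ⟪x, linQ μ b y⟫ := by
  rw [real_inner_fin_three, real_inner_fin_three, linQ_fst, linQ_snd, linQ_thd, linQ_fst, linQ_snd,
    linQ_thd]
  ring

/-- The pressure profile `P(y) = −½⟪Q y, y⟫`. -/
def linP (μ b : ℝ) (y : ℝ³) : ℝ := -(1 / 2 : ℝ) * ⟪linQ μ b y, y⟫

/-- Gradient of a symmetric quadratic form: `∇(−½⟪Qy, y⟫) = −Qy`. -/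
theorem hasGradientAt_quadForm (Q : ℝ³ →L[ℝ] ℝ³) (hQ : ∀ x y : ℝ³, ⟪Q x, y⟫ = ⟪x, Q y⟫) (y : ℝ³) :
    HasGradientAt (fun z : ℝ³ => -(1 / 2 : ℝ) * ⟪Q z, z⟫) (-(Q y)) y := by
  have h1 : HasFDerivAt (fun z : ℝ³ => Q z) Q y := Q.hasFDerivAt
  have h2 : HasFDerivAt (fun z : ℝ³ => z) (ContinuousLinearMap.id ℝ ℝ³) y := hasFDerivAt_id y
  have h3 := (h1.inner (𝕜 := ℝ) h2).const_mul (-(1 / 2 : ℝ))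
  rw [hasGradientAt_iff_hasFDerivAt]
  refine h3.congr_fderiv ?_
  ext h
  simp only [smul_apply, ContinuousLinearMap.comp_apply,
    ContinuousLinearMap.prod_apply, fderivInnerCLM_apply, ContinuousLinearMap.id_apply, smul_eq_mul,
    InnerProductSpace.toDual_apply_apply]
  rw [hQ h y, real_inner_comm (Q y) h, inner_neg_left]
  ring

theorem hasGradientAt_linP (μ b : ℝ) (y : ℝ³) : HasGradientAt (linP μ b) (-(linQ μ b y)) y :=
  hasGradientAt_quadForm (linQ μ b) (linQ_symm μ b) y

theorem gradient_linP (μ b : ℝ) (y : ℝ³) : gradient (linP μ b) y = -(linQ μ b y) :=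
  (hasGradientAt_linP μ b y).gradient

theorem contDiff_linP (μ b : ℝ) {n : WithTop ℕ∞} : ContDiff ℝ n (linP μ b) :=
  contDiff_const.mul ((linQ μ b).contDiff.inner (𝕜 := ℝ) contDiff_id)

/-- A linear map is harmonic. -/
theorem laplacian_linA (μ b : ℝ) (y : ℝ³) : (Δ (⇑(linA μ b) : ℝ³ → ℝ³)) y = 0 := by
  rw [InnerProductSpace.laplacian_eq_iteratedFDeriv_stdOrthonormalBasis]
  refine Finset.sum_eq_zero fun i _ => ?_
  rw [iteratedFDeriv_two_apply]
  have h : fderiv ℝ (⇑(linA μ b)) = fun _ => linA μ b := by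
    funext z
    exact (linA μ b).fderiv
  rw [h, fderiv_const_apply]
  rfl

/-- The convective + similarity terms: `½Ay + ½Ay + A(Ay) = Qy` up to the off-diagonal defect
`b(1 − 2μ)`. -/
theorem linA_profile_coord (μ b : ℝ) (y : ℝ³) :
    ((1 / 2 : ℝ) • linA μ b y + (1 / 2 : ℝ) • linA μ b y + linA μ b (linA μ b y) - linQ μ b y) 0 =
        b * (1 - 2 * μ) * y 1 ∧
      ((1 / 2 : ℝ) • linA μ b y + (1 / 2 : ℝ) • linA μ b y + linA μ b (linA μ b y) - linQ μ b y) 1 =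
        -(b * (1 - 2 * μ)) * y 0 ∧
      ((1 / 2 : ℝ) • linA μ b y + (1 / 2 : ℝ) • linA μ b y + linA μ b (linA μ b y) - linQ μ b y) 2 = 0 := by
  refine ⟨?_, ?_, ?_⟩
  · simp only [PiLp.sub_apply, PiLp.add_apply, PiLp.smul_apply, smul_eq_mul, linA_fst, linA_snd,
      linQ_fst]
    ring
  · simp only [PiLp.sub_apply, PiLp.add_apply, PiLp.smul_apply, smul_eq_mul, linA_fst, linA_snd,
      linQ_snd]
    ring
  · simp only [PiLp.sub_apply, PiLp.add_apply, PiLp.smul_apply, smul_eq_mul, linA_thd, linQ_thd]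
    ring

/-- **Linear Leray profiles.** For every viscosity `ν` and all `μ, b` with `b(1 − 2μ) = 0`,
`(linA μ b, linP μ b)` solves Leray's backward profile system with rate `a = ½`
(`−νΔU + ½U + ½(y·∇)U + (U·∇)U + ∇P = 0`, `div U = 0`).  Two families: the pure strains
`b = 0` (any `μ`: `U = diag(−μ,−μ,2μ)y`, irrotational) and the stretched similarity column
`μ = ½` (any swirl `b`: vorticity `−2b e₂`, stationary in similarity variables). -/
theorem isLerayProfile_linA (ν μ b : ℝ) (h : b * (1 - 2 * μ) = 0) :
    IsLerayProfile ν (1 / 2) (⇑(linA μ b)) (linP μ b) where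
  contDiff_velocity := (linA μ b).contDiff
  contDiff_pressure := contDiff_linP μ b
  profile_eq y := by
    have hc := linA_profile_coord μ b y
    rw [laplacian_linA, smul_zero, neg_zero, zero_add, convect_apply, (linA μ b).fderiv,
      gradient_linP, ← sub_eq_add_neg]
    ext i
    fin_cases i
    · simp only [Fin.zero_eta, Fin.isValue, PiLp.zero_apply]
      rw [hc.1, h, zero_mul]
    · simp only [Fin.mk_one, Fin.isValue, PiLp.zero_apply]
      rw [hc.2.1, h, neg_zero, zero_mul]
    · simp only [Fin.reduceFinMk, Fin.isValue, PiLp.zero_apply]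
      rw [hc.2.2]
  divFree := linA_divFree μ b

/-- The pure-strain profiles (any `μ`). -/
theorem isLerayProfile_strain (ν μ : ℝ) : IsLerayProfile ν (1 / 2) (⇑(linA μ 0)) (linP μ 0) :=
  isLerayProfile_linA ν μ 0 (by ring)

/-- The stretched similarity column (any swirl `b`). -/
theorem isLerayProfile_column (ν b : ℝ) : IsLerayProfile ν (1 / 2) (⇑(linA (1 / 2) b)) (linP (1 / 2) b) :=
  isLerayProfile_linA ν (1 / 2) b (by ring)

/-- On the column the vortex stretching balances Leray's damping exactly: `(Ω·∇)U = U'Ω = Ω`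
for `Ω = curl U = −2b e₂` — so `Ω` is a STEADY state of the similarity vorticity equation
`∂ₛΩ + Ω + ½(y·∇)Ω + (U·∇)Ω = (Ω·∇)U + ΔΩ` (all other terms vanish for constant `Ω`). -/
theorem column_stretching_balance (b : ℝ) (y : ℝ³) :
    linA (1 / 2) b (curl (⇑(linA (1 / 2) b)) y) = curl (⇑(linA (1 / 2) b)) y := by
  rw [curl_linA, map_smul, linA_e2]
  norm_num

/-! ### The physical field: Leray's ansatz, squeezed at any level, outside the class -/

/-- The physical velocity `lin μ b t x = (−t)⁻¹ · linA μ b x`. -/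
def lin (μ b : ℝ) (t : ℝ) (x : ℝ³) : ℝ³ := (-t)⁻¹ • linA μ b x

/-- It is Leray's backward self-similar ansatz (rate `a = ½`, blow-up time `T = 0`) on the
profile `linA μ b`: `u(t, x) = (−t)^{−1/2} U(x/√(−t))` for `t < 0`. -/
theorem lin_eq_lerayBackward (μ b : ℝ) {t : ℝ} (ht : t < 0) (x : ℝ³) :
    lin μ b t x = lerayBackward (1 / 2) 0 (⇑(linA μ b)) t x := by
  rw [lerayBackward_apply, map_smul, smul_smul, lin]
  congr 1
  have h : (2 : ℝ) * (1 / 2) * (0 - t) = -t := by ring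
  rw [h, ← mul_inv, Real.mul_self_sqrt (by linarith : (0 : ℝ) ≤ -t)]

/-- Its similarity orbit is the steady profile: `lerayOrbit (lin μ b) s = linA μ b` for all `s`. -/
theorem lerayOrbit_lin (μ b s : ℝ) (y : ℝ³) : lerayOrbit (lin μ b) s y = linA μ b y := by
  rw [lerayOrbit_apply, lin, neg_neg, map_smul, smul_smul, smul_smul]
  have h : Real.exp (-s / 2) * (Real.exp (-s))⁻¹ * Real.exp (-s / 2) = 1 := by
    rw [← Real.exp_neg, neg_neg, ← Real.exp_add, ← Real.exp_add]
    convert Real.exp_zero using 2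
    ring
  rw [h, one_smul]

/-- Hence its similarity vorticity is the constant `−2b e₂` at every `s` (nonzero for `b ≠ 0`:
`Z_R(s) = 4b²∫φ_R` is a nonzero constant — no backward decay whatsoever). -/
theorem lerayVorticity_lin (μ b s : ℝ) (y : ℝ³) : lerayVorticity (lin μ b) s y = (-2 * b) • e2 := by
  have h : lerayOrbit (lin μ b) s = ⇑(linA μ b) := funext (lerayOrbit_lin μ b s)
  rw [lerayVorticity_apply, h, curl_linA]

theorem hasFDerivAt_lin (μ b t : ℝ) (x : ℝ³) : HasFDerivAt (lin μ b t) ((-t)⁻¹ • linA μ b) x := by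
  change HasFDerivAt (fun x : ℝ³ => (-t)⁻¹ • linA μ b x) ((-t)⁻¹ • linA μ b) x
  exact ((linA μ b).hasFDerivAt).const_smul ((-t)⁻¹)

theorem fderiv_lin (μ b t : ℝ) (x : ℝ³) : fderiv ℝ (lin μ b t) x = (-t)⁻¹ • linA μ b :=
  (hasFDerivAt_lin μ b t x).fderiv

/-- H1: smooth on `t < 0`. -/
theorem lin_h1 (μ b : ℝ) : H1 (lin μ b) := by
  have h1 : ContDiffOn ℝ (⊤ : ℕ∞) (fun p : ℝ × ℝ³ => (-p.1)⁻¹) (Set.Iio 0 ×ˢ Set.univ) := by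
    refine contDiffOn_fst.neg.inv ?_
    rintro ⟨t, x⟩ ⟨ht, -⟩
    simp only [Set.mem_Iio] at ht
    simp only [ne_eq, neg_eq_zero]
    exact ht.ne
  have h2 : ContDiffOn ℝ (⊤ : ℕ∞) (fun p : ℝ × ℝ³ => linA μ b p.2) (Set.Iio 0 ×ˢ Set.univ) :=
    ((linA μ b).contDiff.comp contDiff_snd).contDiffOn
  have h3 : Function.uncurry (lin μ b) = fun p : ℝ × ℝ³ => (-p.1)⁻¹ • linA μ b p.2 := rfl
  rw [H1, h3]
  exact h1.smul h2

/-- H2: divergence free on `t < 0`. -/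
theorem lin_h2 (μ b : ℝ) : H2 (lin μ b) := by
  intro t _ x
  have h0 := linA_divFree μ b x
  rw [divergence_eq_sum_inner_fderiv (EuclideanSpace.basisFun (Fin 3) ℝ), (linA μ b).fderiv] at h0
  rw [divergence_eq_sum_inner_fderiv (EuclideanSpace.basisFun (Fin 3) ℝ), fderiv_lin]
  simp only [smul_apply, real_inner_smul_right]
  rw [← Finset.mul_sum, h0, mul_zero]

/-- **H6 at ANY level `a ≥ −μ`.** The Leray-gauge form `(−t)⟪∇u ξ, ξ⟫ = ⟪linA ξ, ξ⟫ = −μ|ξ|²` on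
the plane `e₀, e₁`: the flow is squeezed with `Λ ≤ −μ`, as negative as desired. -/
theorem lin_h6 (μ b : ℝ) {a : ℝ} (ha : -μ ≤ a) : H6 a (lin μ b) := by
  intro t ht x
  refine ⟨e0, e1, by simp [e0], by simp [e1], by simp [e0, e1, EuclideanSpace.inner_single_left],
    fun α β => ?_⟩
  rw [fderiv_lin, smul_apply, real_inner_smul_left, inner_linA_plane]
  have ht' : (-t) * (-t)⁻¹ = 1 := mul_inv_cancel₀ (by linarith)
  calc -t * ((-t)⁻¹ * (-μ * (α ^ 2 + β ^ 2))) = (-t) * (-t)⁻¹ * (-μ * (α ^ 2 + β ^ 2)) := by ring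
    _ = -μ * (α ^ 2 + β ^ 2) := by rw [ht', one_mul]
    _ ≤ a * (α ^ 2 + β ^ 2) := by nlinarith [sq_nonneg α, sq_nonneg β]

theorem norm_e2 : ‖e2‖ = 1 := by simp [e2]

/-- **Not Type-I bounded** (H4 fails for every constant, unless `μ = 0`): along the axis
`‖u(−1, r e₂)‖ = 2|μ| r` is unbounded.  (H5 fails as well, and so does the typed Oseen clause
H3 — the flow is pressure-driven from infinity; it is in no `𝒦_C`.) -/
theorem lin_not_h4 (μ b C : ℝ) (hμ : μ ≠ 0) : ¬ H4 C (lin μ b) := by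
  intro h
  have hμ' : 0 < |μ| := abs_pos.2 hμ
  set r : ℝ := (|C| + 1) / (2 * |μ|) with hr
  have hr0 : 0 ≤ r := by positivity
  have h1 := h (-1) (by norm_num) (r • e2)
  have hval : lin μ b (-1) (r • e2) = (r * (2 * μ)) • e2 := by
    rw [lin, map_smul, linA_e2, smul_smul, smul_smul]
    norm_num
  rw [hval, norm_smul, norm_e2, mul_one, Real.norm_eq_abs, abs_mul, abs_of_nonneg hr0, abs_mul,
    abs_two] at h1
  norm_num at h1
  have h2 : r * (2 * |μ|) = |C| + 1 := by
    rw [hr]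
    field_simp
  have h3 : |C| + 1 ≤ C := by
    calc |C| + 1 = r * (2 * |μ|) := h2.symm
      _ ≤ C := h1
  linarith [le_abs_self C]

/-! ### H5 fails as well: the Morrey slice bound along the axis -/

/-- The unit ball has positive volume. -/
theorem V1_pos : 0 < V1 :=
  ENNReal.toReal_pos (Metric.measure_ball_pos volume (0 : ℝ³) one_pos).ne' measure_ball_lt_top.ne

/-- At time `t = −1` the physical field is the profile itself. -/
theorem lin_neg_one (μ b : ℝ) (x : ℝ³) : lin μ b (-1) x = linA μ b x := by
  simp [lin]

/-- Axial lower bound: on the unit ball about `(K+1)e₂`, `‖U‖ ≥ 2|μ|K`. -/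
theorem linA_axis_lower (μ b : ℝ) {K : ℝ} (hK : 0 ≤ K) {x : ℝ³}
    (hx : x ∈ Metric.ball ((K + 1) • e2) 1) : (2 * |μ| * K) ^ 2 ≤ ‖linA μ b x‖ ^ 2 := by
  rw [Metric.mem_ball, dist_eq_norm] at hx
  have h1 : |x 2 - (K + 1)| ≤ ‖x - (K + 1) • e2‖ := by
    convert PiLp.norm_apply_le (x - (K + 1) • e2) 2 using 1
    simp [e2, Real.norm_eq_abs]
  have hx2 : K < x 2 := by
    have h3 : |x 2 - (K + 1)| < 1 := lt_of_le_of_lt h1 hx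
    have h4 := neg_abs_le (x 2 - (K + 1))
    linarith
  have hcomp : |2 * μ * x 2| ≤ ‖linA μ b x‖ := by
    convert PiLp.norm_apply_le (linA μ b x) 2 using 1
    rw [Real.norm_eq_abs, linA_thd]
  have hlow : 2 * |μ| * K ≤ |2 * μ * x 2| := by
    rw [abs_mul, abs_mul, abs_two, abs_of_pos (hK.trans_lt hx2)]
    exact mul_le_mul_of_nonneg_left hx2.le (by positivity)
  exact pow_le_pow_left₀ (by positivity) (hlow.trans hcomp) 2

/-- Integrated form: `(2|μ|K)²|B₁| ≤ ∫_{B₁((K+1)e₂)} ‖U‖²`. -/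
theorem linA_ball_energy_lower (μ b : ℝ) {K : ℝ} (hK : 0 ≤ K) :
    (2 * |μ| * K) ^ 2 * V1 ≤ ∫ x in Metric.ball ((K + 1) • e2) 1, ‖linA μ b x‖ ^ 2 := by
  have hcont : Continuous fun x : ℝ³ => ‖linA μ b x‖ ^ 2 := (linA μ b).continuous.norm.pow 2
  have hint : IntegrableOn (fun x : ℝ³ => ‖linA μ b x‖ ^ 2) (Metric.ball ((K + 1) • e2) 1) :=
    (hcont.continuousOn.integrableOn_compact (isCompact_closedBall _ _)).mono_set
      Metric.ball_subset_closedBall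
  have hfin : volume (Metric.ball ((K + 1) • e2) (1 : ℝ)) ≠ ⊤ := measure_ball_lt_top.ne
  calc (2 * |μ| * K) ^ 2 * V1 = ∫ _ in Metric.ball ((K + 1) • e2) (1 : ℝ), (2 * |μ| * K) ^ 2 := by
        rw [setIntegral_const, smul_eq_mul, measureReal_def, volume_ball_toReal _ one_pos]
        ring
    _ ≤ ∫ x in Metric.ball ((K + 1) • e2) 1, ‖linA μ b x‖ ^ 2 :=
        setIntegral_mono_on (integrableOn_const hfin) hint measurableSet_ball fun x hx =>
          linA_axis_lower μ b hK hx

/-- **H5 fails too** (the slice Morrey bound H5a, for every constant `C`, unless `μ = 0`): on the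
unit balls `B₁((K+1)e₂)` along the axis, `∫_{B₁} ‖u(−1)‖² ≥ (2|μ|K)²|B₁| → ∞` as `K → ∞`.  So the
linear flows lie in no `𝒦_C` for two independent reasons (H4 and H5a), besides the Oseen gauge H3. -/
theorem lin_not_h5 (μ b C : ℝ) (hμ : μ ≠ 0) : ¬ H5 C (lin μ b) := by
  have hμ' : 0 < |μ| := abs_pos.2 hμ
  have hV := V1_pos
  -- a level `N ≥ 1` with `N² V1 > C`, and the axial distance `K` with `2|μ|K = N`
  obtain ⟨N, hN1, hN2⟩ : ∃ N : ℝ, 1 ≤ N ∧ C < N ^ 2 * V1 := by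
    refine ⟨(|C| + 1) / V1 + 1, ?_, ?_⟩
    · have : 0 ≤ (|C| + 1) / V1 := by positivity
      linarith
    · have h1 : ((|C| + 1) / V1 + 1) * V1 = |C| + 1 + V1 := by field_simp
      have h2 : ((|C| + 1) / V1 + 1) * V1 ≤ ((|C| + 1) / V1 + 1) ^ 2 * V1 := by
        have h0 : 1 ≤ (|C| + 1) / V1 + 1 := by
          have : 0 ≤ (|C| + 1) / V1 := by positivity
          linarith
        have h3 : 0 ≤ ((|C| + 1) / V1 + 1) * V1 := by positivity
        nlinarith
      linarith [le_abs_self C]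
  obtain ⟨K, hK0, hKN⟩ : ∃ K : ℝ, 0 ≤ K ∧ 2 * |μ| * K = N := by
    refine ⟨N / (2 * |μ|), by positivity, ?_⟩
    field_simp
  intro h
  have h5a := (h ((K + 1) • e2) (-1 / 2) 1 (by norm_num) one_pos).1 (-1) (by norm_num) (by norm_num)
  rw [inv_one, one_mul] at h5a
  simp_rw [lin_neg_one] at h5a
  have hlow := linA_ball_energy_lower μ b hK0
  rw [hKN] at hlow
  linarith

/-! ### The self-similar shadow of the crux has no content without normalisation -/

/-- "Every Leray profile (`ν = 1`, `a = ½`) whose strain is squeezed below `a` on some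
orthonormal 2-frame at every point vanishes identically" — `MustSqueezeAt a` restricted to the
self-similar sector with the normalisation H4–H5 (and the Oseen gauge H3) removed. -/
def MustSqueezeProfiles (a : ℝ) : Prop :=
  ∀ (U : ℝ³ → ℝ³) (P : ℝ³ → ℝ), IsLerayProfile 1 (1 / 2) U P →
    (∀ y, ∃ v w : ℝ³, ‖v‖ = 1 ∧ ‖w‖ = 1 ∧ ⟪v, w⟫ = 0 ∧
      ∀ α β : ℝ, ⟪fderiv ℝ U y (α • v + β • w), α • v + β • w⟫ ≤ a * (α ^ 2 + β ^ 2)) →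
    ∀ y, U y = 0

/-- **False at every threshold.** The pure strain `linA μ 0` with `μ = max 1 (−a)` is a nonzero
Leray profile squeezed below `−μ ≤ a`.  So in the self-similar sector the squeeze hypothesis is
void by itself: NRŠ 1996 / Tsai 1998 exclude profiles through `L³` / local-energy hypotheses
(our H4–H5), for every value of `Λ`; any proof of the crux must spend H4 ∧ H5 (cf.
`mustSqueeze_false_without_H4H5`, which needed `a ≥ 0`; here `a` is arbitrary). -/
theorem not_mustSqueezeProfiles (a : ℝ) : ¬ MustSqueezeProfiles a := by
  intro h
  set μ : ℝ := max 1 (-a) with hμ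
  have hμ1 : 1 ≤ μ := le_max_left _ _
  have hμa : -μ ≤ a := by
    have : -a ≤ μ := le_max_right _ _
    linarith
  have key := h (⇑(linA μ 0)) (linP μ 0) (isLerayProfile_strain 1 μ) (fun y =>
    ⟨e0, e1, by simp [e0], by simp [e1], by simp [e0, e1, EuclideanSpace.inner_single_left],
      fun α β => by
        rw [(linA μ 0).fderiv, inner_linA_plane]
        nlinarith [sq_nonneg α, sq_nonneg β]⟩) e2
  rw [linA_e2] at key
  have h2 : ‖(2 * μ) • e2‖ = 2 * μ := by
    rw [norm_smul, norm_e2, mul_one, Real.norm_eq_abs, abs_of_nonneg (by linarith)]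
  rw [key, norm_zero] at h2
  linarith

/-! ## §12 Targets — the LEVER `stub_signedBudget` is false without its class hypotheses

`Targets.SignedBudgetWithoutClass` is the lead's `stub_signedBudget` (skeleton v1, sha 75fd2eb7)
with its two CLASS hypotheses deleted — `IsTypeIAncientMild C u` and the similarity bound
`‖U‖ ≤ C` — everything else verbatim (squeeze `Λ ≤ a`, `0 ≤ a`, continuity of the ball gradient
energies, the div–curl comparison with constant `κ'`, and the full conclusion).
`Targets.signedBudget_false_without_class`: it is FALSE, witnessed by the stretched similarity
column `u = lin ½ 1` of §11 with `a = 0`, `κ' = 0`: the squeeze holds (`Λ ≡ −½`), `E(ρ, ·)` is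
constant (`ballGradEnergy_col`: `(7/2)ρ³|B₁|`), the comparison holds (`(7/2)∫φ_R ≤ 4∫φ_R`), but
`Z_R ≡ 4∫φ_R ≥ 4R³|B₁|` (`cutoffEnstrophy_col`, `integral_cutoff_ge`) is constant in `s`, so the
budget at `s = 0` would force `2R³|B₁| ≤ K(0) ≤ |κ|(56|B₁| + 1)R²` for all `R ≥ 1`.  Hence the lever
genuinely spends the class — concretely `‖U‖_∞ ≤ C` in the constants of the transport and cubic
fluxes (both `∼ R³` on the column, against `E(2R)/R ∼ R²`).  Module form (proposed):
`Theorems/MustSqueeze/Negative/ClassLoadBearing.lean` (with the companion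
`Targets.divCurlBalls_false_without_class`: `stub_divCurlBalls` minus `IsTypeIAncientMild` and the
Morrey bound is FALSE — witness the irrotational pure strain `lin 1 0`, `Z_R ≡ 0`,
`∫φ_R|∇U|²_F = 6∫φ_R ≥ 6R³|B₁|`; the comparison spends H5a). -/

namespace Targets

/-! ### The cutoff `φ_R(y) = smoothTransition (2 − ‖y‖²/R²)` of the skeleton -/

/-- `0 ≤ φ_R`. -/
theorem cutoff_nonneg (R : ℝ) (y : ℝ³) : 0 ≤ Real.smoothTransition (2 - ‖y‖ ^ 2 / R ^ 2) :=
  Real.smoothTransition.nonneg _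

/-- `φ_R = 1` on the ball `B_R`. -/
theorem cutoff_eq_one {R : ℝ} (hR : 0 < R) {y : ℝ³} (hy : y ∈ Metric.ball (0 : ℝ³) R) :
    Real.smoothTransition (2 - ‖y‖ ^ 2 / R ^ 2) = 1 := by
  refine Real.smoothTransition.one_of_one_le ?_
  rw [Metric.mem_ball, dist_zero_right] at hy
  have h1 : ‖y‖ ^ 2 < R ^ 2 := by nlinarith [norm_nonneg y]
  have h2 : ‖y‖ ^ 2 / R ^ 2 < 1 := (div_lt_one (by positivity)).2 h1
  linarith

/-- `φ_R = 0` outside the ball `B_{2R}`. -/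
theorem cutoff_eq_zero {R : ℝ} (hR : 0 < R) {y : ℝ³} (hy : 2 * R ≤ ‖y‖) :
    Real.smoothTransition (2 - ‖y‖ ^ 2 / R ^ 2) = 0 := by
  refine Real.smoothTransition.zero_of_nonpos ?_
  have h1 : 4 * R ^ 2 ≤ ‖y‖ ^ 2 := by nlinarith
  have h2 : 2 ≤ ‖y‖ ^ 2 / R ^ 2 := by
    rw [le_div_iff₀ (by positivity)]
    nlinarith [sq_nonneg R]
  linarith

/-- `φ_R` is continuous. -/
theorem continuous_cutoff (R : ℝ) : Continuous fun y : ℝ³ => Real.smoothTransition (2 - ‖y‖ ^ 2 / R ^ 2) :=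
  Real.smoothTransition.continuous.comp (continuous_const.sub ((continuous_norm.pow 2).div_const _))

/-- `φ_R` has compact support (inside the closed ball of radius `2R`). -/
theorem hasCompactSupport_cutoff {R : ℝ} (hR : 0 < R) :
    HasCompactSupport fun y : ℝ³ => Real.smoothTransition (2 - ‖y‖ ^ 2 / R ^ 2) := by
  refine HasCompactSupport.of_support_subset_isCompact (isCompact_closedBall (0 : ℝ³) (2 * R)) ?_
  intro y hy
  rw [Metric.mem_closedBall, dist_zero_right]
  by_contra h
  exact hy (cutoff_eq_zero hR (not_le.1 h).le)

/-- `φ_R` is integrable. -/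
theorem integrable_cutoff {R : ℝ} (hR : 0 < R) :
    Integrable fun y : ℝ³ => Real.smoothTransition (2 - ‖y‖ ^ 2 / R ^ 2) :=
  (continuous_cutoff R).integrable_of_hasCompactSupport (hasCompactSupport_cutoff hR)

/-- `∫φ_R ≥ R³|B₁|`. -/
theorem integral_cutoff_ge {R : ℝ} (hR : 0 < R) :
    R ^ 3 * V1 ≤ ∫ y : ℝ³, Real.smoothTransition (2 - ‖y‖ ^ 2 / R ^ 2) := by
  calc R ^ 3 * V1 = ∫ _ in Metric.ball (0 : ℝ³) R, (1 : ℝ) := by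
        rw [setIntegral_const, smul_eq_mul, mul_one, measureReal_def, volume_ball_toReal 0 hR]
    _ = ∫ y in Metric.ball (0 : ℝ³) R, Real.smoothTransition (2 - ‖y‖ ^ 2 / R ^ 2) :=
        setIntegral_congr_fun measurableSet_ball fun y hy => (cutoff_eq_one hR hy).symm
    _ ≤ ∫ y : ℝ³, Real.smoothTransition (2 - ‖y‖ ^ 2 / R ^ 2) :=
        setIntegral_le_integral (integrable_cutoff hR) (Eventually.of_forall (cutoff_nonneg R))

/-! ### The column `u = lin ½ 1` read through the skeleton's functionals -/

/-- The similarity orbit of the column is the steady profile. -/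
theorem lerayOrbit_col (s : ℝ) : lerayOrbit (lin (1 / 2) 1) s = ⇑(linA (1 / 2) 1) :=
  funext (lerayOrbit_lin _ _ s)

/-- `|Ω|² ≡ 4` for the column. -/
theorem norm_lerayVorticity_col_sq (s : ℝ) (y : ℝ³) : ‖lerayVorticity (lin (1 / 2) 1) s y‖ ^ 2 = 4 := by
  rw [lerayVorticity_lin, norm_smul, norm_e2, mul_one, Real.norm_eq_abs]
  norm_num

/-- The localised similarity enstrophy of the column: `Z_R(s) = 4∫φ_R`, constant in `s`. -/
theorem cutoffEnstrophy_col (R s : ℝ) :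
    (∫ y : ℝ³, Real.smoothTransition (2 - ‖y‖ ^ 2 / R ^ 2) * ‖lerayVorticity (lin (1 / 2) 1) s y‖ ^ 2) =
      4 * ∫ y : ℝ³, Real.smoothTransition (2 - ‖y‖ ^ 2 / R ^ 2) := by
  simp_rw [norm_lerayVorticity_col_sq]
  rw [integral_mul_const]
  ring

/-- `‖linA μ b y‖²` in coordinates. -/
theorem norm_linA_sq (μ b : ℝ) (y : ℝ³) :
    ‖linA μ b y‖ ^ 2 = (-μ * y 0 + b * y 1) ^ 2 + (-b * y 0 - μ * y 1) ^ 2 + (2 * μ * y 2) ^ 2 := by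
  rw [EuclideanSpace.real_norm_sq_eq, Fin.sum_univ_three, linA_fst, linA_snd, linA_thd]

/-- The Frobenius norm of the column gradient: `|∇U|²_F = ¼ + 1 + 1 + ¼ + 1 = 7/2`. -/
theorem frobeniusNormSq_col : frobeniusNormSq (linA (1 / 2) 1 : ℝ³ →L[ℝ] ℝ³) = 7 / 2 := by
  rw [frobeniusNormSq_eq_sum (EuclideanSpace.basisFun (Fin 3) ℝ), Fin.sum_univ_three]
  simp [EuclideanSpace.basisFun_apply, norm_linA_sq]
  norm_num

/-- The ball gradient energies of the column: `E(ρ, s) = (7/2)ρ³|B₁|`. -/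
theorem ballGradEnergy_col {ρ : ℝ} (hρ : 0 < ρ) (s : ℝ) :
    (∫ y in Metric.ball (0 : ℝ³) ρ, frobeniusNormSq (fderiv ℝ (lerayOrbit (lin (1 / 2) 1) s) y)) =
      7 / 2 * (ρ ^ 3 * V1) := by
  rw [lerayOrbit_col]
  simp_rw [ContinuousLinearMap.fderiv, frobeniusNormSq_col]
  rw [setIntegral_const, smul_eq_mul, measureReal_def, volume_ball_toReal 0 hρ]
  ring

/-- The cutoff gradient energy of the column: `∫φ_R|∇U|²_F = (7/2)∫φ_R`. -/
theorem cutoffGradEnergy_col (R s : ℝ) :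
    (∫ y : ℝ³, Real.smoothTransition (2 - ‖y‖ ^ 2 / R ^ 2) *
        frobeniusNormSq (fderiv ℝ (lerayOrbit (lin (1 / 2) 1) s) y)) =
      7 / 2 * ∫ y : ℝ³, Real.smoothTransition (2 - ‖y‖ ^ 2 / R ^ 2) := by
  rw [lerayOrbit_col]
  simp_rw [ContinuousLinearMap.fderiv, frobeniusNormSq_col]
  rw [integral_mul_const]
  ring

/-- The column is squeezed in the Leray gauge with threshold `0`: `Λ ≤ 0` everywhere. -/
theorem lerayMiddleStrain_col_le (t : ℝ) (ht : t < 0) (x : ℝ³) :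
    lerayMiddleStrain (lin (1 / 2) 1) t x ≤ 0 :=
  (lerayMiddleStrain_le_iff ht 0).2 (lin_h6 (1 / 2) 1 (by norm_num : -(1 / 2 : ℝ) ≤ 0) t ht x)

/-! ### The stub without its class hypotheses, and its failure -/

/-- `stub_signedBudget` (lead skeleton v1 of line outward-drift-signed-flux) with the CLASS
hypotheses `IsTypeIAncientMild C u` and `∀ s y, ‖lerayOrbit u s y‖ ≤ C` DELETED; the squeeze,
`0 ≤ a`, the continuity of the ball gradient energies, the div–curl comparison and the conclusion
are verbatim. -/
def SignedBudgetWithoutClass : Prop :=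
  ∀ (a κ' : ℝ) (u : ℝ → ℝ³ → ℝ³),
    (∀ t < 0, ∀ x, lerayMiddleStrain u t x ≤ a) → 0 ≤ a →
    (∀ ρ : ℝ, 0 < ρ →
      Continuous fun s => ∫ y in Metric.ball (0 : ℝ³) ρ, frobeniusNormSq (fderiv ℝ (lerayOrbit u s) y)) →
    (∀ (R s : ℝ), 1 ≤ R →
      (∫ y, Real.smoothTransition (2 - ‖y‖ ^ 2 / R ^ 2) * frobeniusNormSq (fderiv ℝ (lerayOrbit u s) y)) ≤
        (∫ y, Real.smoothTransition (2 - ‖y‖ ^ 2 / R ^ 2) * ‖lerayVorticity u s y‖ ^ 2) +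
          κ' * Real.sqrt ((∫ y in Metric.ball (0 : ℝ³) (2 * R),
            frobeniusNormSq (fderiv ℝ (lerayOrbit u s) y)) / R)) →
    ∃ κ : ℝ, ∀ R : ℝ, 1 ≤ R →
      Differentiable ℝ (fun s => ∫ y, Real.smoothTransition (2 - ‖y‖ ^ 2 / R ^ 2) * ‖lerayVorticity u s y‖ ^ 2) ∧
      ∃ K : ℝ → ℝ, Continuous K ∧ (∀ s, 0 ≤ K s) ∧
        (∀ s, K s ≤ κ * ((∫ y in Metric.ball (0 : ℝ³) (2 * R), frobeniusNormSq (fderiv ℝ (lerayOrbit u s) y)) / R +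
          Real.sqrt ((∫ y in Metric.ball (0 : ℝ³) (2 * R), frobeniusNormSq (fderiv ℝ (lerayOrbit u s) y)) / R))) ∧
        ∀ s, deriv (fun s => ∫ y, Real.smoothTransition (2 - ‖y‖ ^ 2 / R ^ 2) * ‖lerayVorticity u s y‖ ^ 2) s ≤
          -(2 * (1 / 4 - a)) * (∫ y, Real.smoothTransition (2 - ‖y‖ ^ 2 / R ^ 2) * ‖lerayVorticity u s y‖ ^ 2) + K s

/-- `√x ≤ x + 1` for `x ≥ 0`. -/
theorem sqrt_le_add_one {x : ℝ} (hx : 0 ≤ x) : Real.sqrt x ≤ x + 1 := by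
  nlinarith [Real.sq_sqrt hx, Real.sqrt_nonneg x, sq_nonneg (Real.sqrt x - 1)]

/-- **The lever is false without its class hypotheses.**  Witness: the stretched similarity
column `u = lin ½ 1` (exact ancient Navier–Stokes, `Negative.LinearLerayProfiles`), `a = 0`,
`κ' = 0`: every remaining hypothesis holds (`Λ ≡ −½ ≤ 0`; `E(ρ, ·)` constant; comparison
`(7/2)∫φ_R ≤ 4∫φ_R`), but `Z_R ≡ 4∫φ_R ≥ 4R³|B₁|` is constant in `s`, so the budget at `s = 0`
would give `2R³|B₁| ≤ K(0) ≤ |κ|(56|B₁| + 1)R²` for every `R ≥ 1` — false at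
`R = |κ|(56|B₁| + 1)/(2|B₁|) + 1`.  Hence `stub_signedBudget` genuinely spends
`IsTypeIAncientMild` / `‖U‖ ≤ C` (in the flux constants), as the Disproof's §11 explains. -/
theorem signedBudget_false_without_class : ¬ SignedBudgetWithoutClass := by
  intro h
  have hV : 0 < V1 :=
    ENNReal.toReal_pos (Metric.measure_ball_pos volume (0 : ℝ³) one_pos).ne' measure_ball_lt_top.ne
  -- the remaining hypotheses hold for the column with `a = 0`, `κ' = 0`
  have hcont : ∀ ρ : ℝ, 0 < ρ → Continuous fun s =>
      ∫ y in Metric.ball (0 : ℝ³) ρ, frobeniusNormSq (fderiv ℝ (lerayOrbit (lin (1 / 2) 1) s) y) := by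
    intro ρ hρ
    have : (fun s => ∫ y in Metric.ball (0 : ℝ³) ρ,
        frobeniusNormSq (fderiv ℝ (lerayOrbit (lin (1 / 2) 1) s) y)) = fun _ => 7 / 2 * (ρ ^ 3 * V1) :=
      funext fun s => ballGradEnergy_col hρ s
    rw [this]
    exact continuous_const
  have hcomp : ∀ (R s : ℝ), 1 ≤ R →
      (∫ y, Real.smoothTransition (2 - ‖y‖ ^ 2 / R ^ 2) *
          frobeniusNormSq (fderiv ℝ (lerayOrbit (lin (1 / 2) 1) s) y)) ≤
        (∫ y, Real.smoothTransition (2 - ‖y‖ ^ 2 / R ^ 2) * ‖lerayVorticity (lin (1 / 2) 1) s y‖ ^ 2) +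
          0 * Real.sqrt ((∫ y in Metric.ball (0 : ℝ³) (2 * R),
            frobeniusNormSq (fderiv ℝ (lerayOrbit (lin (1 / 2) 1) s) y)) / R) := by
    intro R s _
    rw [cutoffGradEnergy_col, cutoffEnstrophy_col, zero_mul, add_zero]
    have hI : 0 ≤ ∫ y : ℝ³, Real.smoothTransition (2 - ‖y‖ ^ 2 / R ^ 2) :=
      integral_nonneg (cutoff_nonneg R)
    nlinarith
  obtain ⟨κ, hκ⟩ := h 0 0 (lin (1 / 2) 1) lerayMiddleStrain_col_le le_rfl hcont hcomp
  -- evaluate the budget at a large radius and `s = 0`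
  set R : ℝ := |κ| * (56 * V1 + 1) / (2 * V1) + 1 with hR
  have hR1 : 1 ≤ R := by
    have : 0 ≤ |κ| * (56 * V1 + 1) / (2 * V1) := by positivity
    linarith
  have hR0 : 0 < R := by linarith
  obtain ⟨-, K, -, hK0, hKle, hderiv⟩ := hκ R hR1
  have hZ : (fun s => ∫ y : ℝ³, Real.smoothTransition (2 - ‖y‖ ^ 2 / R ^ 2) *
      ‖lerayVorticity (lin (1 / 2) 1) s y‖ ^ 2) =
      fun _ => 4 * ∫ y : ℝ³, Real.smoothTransition (2 - ‖y‖ ^ 2 / R ^ 2) :=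
    funext (cutoffEnstrophy_col R)
  have hd := hderiv 0
  rw [hZ, deriv_const, cutoffEnstrophy_col] at hd
  have hE : (∫ y in Metric.ball (0 : ℝ³) (2 * R),
      frobeniusNormSq (fderiv ℝ (lerayOrbit (lin (1 / 2) 1) 0) y)) = 28 * R ^ 3 * V1 := by
    rw [ballGradEnergy_col (by linarith) 0]
    ring
  have hK := hKle 0
  rw [hE] at hK
  -- sizes
  set I : ℝ := ∫ y : ℝ³, Real.smoothTransition (2 - ‖y‖ ^ 2 / R ^ 2) with hI
  have hIge : R ^ 3 * V1 ≤ I := integral_cutoff_ge hR0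
  have hx : 28 * R ^ 3 * V1 / R = 28 * R ^ 2 * V1 := by
    field_simp
  rw [hx] at hK
  have hx0 : 0 ≤ 28 * R ^ 2 * V1 := by positivity
  have hsq : Real.sqrt (28 * R ^ 2 * V1) ≤ 28 * R ^ 2 * V1 + 1 := sqrt_le_add_one hx0
  have hK' : K 0 ≤ |κ| * (56 * R ^ 2 * V1 + 1) := by
    calc K 0 ≤ κ * (28 * R ^ 2 * V1 + Real.sqrt (28 * R ^ 2 * V1)) := hK
      _ ≤ |κ| * (28 * R ^ 2 * V1 + Real.sqrt (28 * R ^ 2 * V1)) :=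
          mul_le_mul_of_nonneg_right (le_abs_self κ) (by positivity)
      _ ≤ |κ| * (56 * R ^ 2 * V1 + 1) := by
          refine mul_le_mul_of_nonneg_left ?_ (abs_nonneg κ)
          linarith
  -- the budget at `s = 0`: `0 ≤ −½ · 4I + K 0`, i.e. `2I ≤ K 0`
  have hbud : 2 * I ≤ K 0 := by
    have := hd
    norm_num at this
    linarith
  -- so `2 R³ V1 ≤ |κ|(56 R² V1 + 1) ≤ |κ|(56 V1 + 1) R²`, i.e. `2 R V1 ≤ |κ|(56 V1 + 1)`
  have h1 : 2 * (R ^ 3 * V1) ≤ |κ| * (56 * V1 + 1) * R ^ 2 := by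
    have hR2 : 1 ≤ R ^ 2 := by nlinarith
    have : |κ| * (56 * R ^ 2 * V1 + 1) ≤ |κ| * (56 * V1 + 1) * R ^ 2 := by
      have hk : 0 ≤ |κ| := abs_nonneg κ
      nlinarith [mul_nonneg hk (by linarith : (0 : ℝ) ≤ R ^ 2 - 1)]
    linarith
  have h2 : 2 * R * V1 ≤ |κ| * (56 * V1 + 1) := by
    have hR2 : 0 < R ^ 2 := by positivity
    have : 2 * R * V1 * R ^ 2 ≤ |κ| * (56 * V1 + 1) * R ^ 2 := by nlinarith
    exact le_of_mul_le_mul_right this hR2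
  -- contradiction with the choice of `R`
  have h3 : |κ| * (56 * V1 + 1) < 2 * R * V1 := by
    have : 2 * R * V1 = |κ| * (56 * V1 + 1) + 2 * V1 := by
      rw [hR]
      field_simp
    rw [this]
    linarith
  linarith

/-! ### The div–curl comparison stub without its class hypotheses -/

/-- `|Ω|² ≡ 0` for the pure strain `u = lin 1 0` (irrotational). -/
theorem lerayVorticity_strain (s : ℝ) (y : ℝ³) : lerayVorticity (lin 1 0) s y = 0 := by
  rw [lerayVorticity_lin]
  simp

/-- The similarity orbit of the pure strain is the steady profile. -/
theorem lerayOrbit_strain (s : ℝ) : lerayOrbit (lin 1 0) s = ⇑(linA 1 0) :=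
  funext (lerayOrbit_lin _ _ s)

/-- The Frobenius norm of the pure-strain gradient `diag(−1, −1, 2)`: `6`. -/
theorem frobeniusNormSq_strain : frobeniusNormSq (linA 1 0 : ℝ³ →L[ℝ] ℝ³) = 6 := by
  rw [frobeniusNormSq_eq_sum (EuclideanSpace.basisFun (Fin 3) ℝ), Fin.sum_univ_three]
  simp [EuclideanSpace.basisFun_apply, norm_linA_sq]
  norm_num

/-- The ball gradient energies of the pure strain: `E(ρ, s) = 6ρ³|B₁|`. -/
theorem ballGradEnergy_strain {ρ : ℝ} (hρ : 0 < ρ) (s : ℝ) :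
    (∫ y in Metric.ball (0 : ℝ³) ρ, frobeniusNormSq (fderiv ℝ (lerayOrbit (lin 1 0) s) y)) =
      6 * (ρ ^ 3 * V1) := by
  rw [lerayOrbit_strain]
  simp_rw [ContinuousLinearMap.fderiv, frobeniusNormSq_strain]
  rw [setIntegral_const, smul_eq_mul, measureReal_def, volume_ball_toReal 0 hρ]
  ring

/-- The cutoff gradient energy of the pure strain: `∫φ_R|∇U|²_F = 6∫φ_R`. -/
theorem cutoffGradEnergy_strain (R s : ℝ) :
    (∫ y : ℝ³, Real.smoothTransition (2 - ‖y‖ ^ 2 / R ^ 2) *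
        frobeniusNormSq (fderiv ℝ (lerayOrbit (lin 1 0) s) y)) =
      6 * ∫ y : ℝ³, Real.smoothTransition (2 - ‖y‖ ^ 2 / R ^ 2) := by
  rw [lerayOrbit_strain]
  simp_rw [ContinuousLinearMap.fderiv, frobeniusNormSq_strain]
  rw [integral_mul_const]
  ring

/-- `stub_divCurlBalls` (lead skeleton v1) with the CLASS hypotheses `IsTypeIAncientMild C u` and the
Morrey slice bound `∫_{B_ρ(y₀)}|U(s)|² ≤ Cρ` DELETED; the four conclusions verbatim. -/
def DivCurlBallsWithoutClass : Prop :=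
  ∀ (u : ℝ → ℝ³ → ℝ³), ∃ κ' : ℝ, ∀ (R s : ℝ), 1 ≤ R →
      (∫ y, Real.smoothTransition (2 - ‖y‖ ^ 2 / R ^ 2) * ‖lerayVorticity u s y‖ ^ 2) ≤
          6 * ∫ y in Metric.ball (0 : ℝ³) (2 * R), frobeniusNormSq (fderiv ℝ (lerayOrbit u s) y) ∧
      (∫ y, Real.smoothTransition (2 - ‖y‖ ^ 2 / R ^ 2) * frobeniusNormSq (fderiv ℝ (lerayOrbit u s) y)) ≤
          (∫ y, Real.smoothTransition (2 - ‖y‖ ^ 2 / R ^ 2) * ‖lerayVorticity u s y‖ ^ 2) +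
            κ' * Real.sqrt ((∫ y in Metric.ball (0 : ℝ³) (2 * R),
              frobeniusNormSq (fderiv ℝ (lerayOrbit u s) y)) / R) ∧
      (∫ y in Metric.ball (0 : ℝ³) R, frobeniusNormSq (fderiv ℝ (lerayOrbit u s) y)) ≤
          (∫ y, Real.smoothTransition (2 - ‖y‖ ^ 2 / R ^ 2) * frobeniusNormSq (fderiv ℝ (lerayOrbit u s) y)) ∧
      (∀ R' : ℝ, R ≤ R' →
        (∫ y, Real.smoothTransition (2 - ‖y‖ ^ 2 / R ^ 2) * ‖lerayVorticity u s y‖ ^ 2) ≤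
          (∫ y, Real.smoothTransition (2 - ‖y‖ ^ 2 / R' ^ 2) * ‖lerayVorticity u s y‖ ^ 2))

/-- **The div–curl comparison is false without the class** (it spends the Morrey bound, i.e. H5a,
through the flux `∫φ tr(∇U²) = −∫∇φ·((U·∇)U)`).  Witness: the irrotational pure strain
`u = lin 1 0` (`U = diag(−1,−1,2)y`, an exact Leray profile, smooth, divergence free, squeezed
with `Λ ≡ −1`): `Z_R ≡ 0` while `∫φ_R|∇U|²_F = 6∫φ_R ≥ 6R³|B₁|` and `E(2R) = 48R³|B₁|`, so the
second conclusion would force `6R³|B₁| ≤ |κ'|(48|B₁| + 1)R²` for all `R ≥ 1`. -/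
theorem divCurlBalls_false_without_class : ¬ DivCurlBallsWithoutClass := by
  intro h
  have hV : 0 < V1 :=
    ENNReal.toReal_pos (Metric.measure_ball_pos volume (0 : ℝ³) one_pos).ne' measure_ball_lt_top.ne
  obtain ⟨κ', hκ⟩ := h (lin 1 0)
  set R : ℝ := |κ'| * (48 * V1 + 1) / (6 * V1) + 1 with hR
  have hR1 : 1 ≤ R := by
    have : 0 ≤ |κ'| * (48 * V1 + 1) / (6 * V1) := by positivity
    linarith
  have hR0 : 0 < R := by linarith
  obtain ⟨-, h2, -, -⟩ := hκ R 0 hR1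
  rw [cutoffGradEnergy_strain, ballGradEnergy_strain (by linarith) 0] at h2
  simp_rw [lerayVorticity_strain, norm_zero] at h2
  norm_num at h2
  -- h2 : 6 * ∫φ_R ≤ κ' * √(6 * ((2R)³ V1) / R)
  set I : ℝ := ∫ y : ℝ³, Real.smoothTransition (2 - ‖y‖ ^ 2 / R ^ 2) with hI
  have hIge : R ^ 3 * V1 ≤ I := integral_cutoff_ge hR0
  have hx : (6 : ℝ) * ((2 * R) ^ 3 * V1) / R = 48 * R ^ 2 * V1 := by
    field_simp
    ring
  rw [hx] at h2
  have hx0 : 0 ≤ 48 * R ^ 2 * V1 := by positivity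
  have hsq : Real.sqrt (48 * R ^ 2 * V1) ≤ 48 * R ^ 2 * V1 + 1 := sqrt_le_add_one hx0
  have h3 : 6 * I ≤ |κ'| * (48 * R ^ 2 * V1 + 1) := by
    calc 6 * I ≤ κ' * Real.sqrt (48 * R ^ 2 * V1) := h2
      _ ≤ |κ'| * Real.sqrt (48 * R ^ 2 * V1) :=
          mul_le_mul_of_nonneg_right (le_abs_self κ') (Real.sqrt_nonneg _)
      _ ≤ |κ'| * (48 * R ^ 2 * V1 + 1) := mul_le_mul_of_nonneg_left hsq (abs_nonneg κ')
  have h4 : 6 * (R ^ 3 * V1) ≤ |κ'| * (48 * V1 + 1) * R ^ 2 := by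
    have hk : 0 ≤ |κ'| := abs_nonneg κ'
    have : |κ'| * (48 * R ^ 2 * V1 + 1) ≤ |κ'| * (48 * V1 + 1) * R ^ 2 := by
      nlinarith [mul_nonneg hk (by nlinarith : (0 : ℝ) ≤ R ^ 2 - 1)]
    linarith
  have h5 : 6 * R * V1 ≤ |κ'| * (48 * V1 + 1) := by
    have hR2 : 0 < R ^ 2 := by positivity
    have : 6 * R * V1 * R ^ 2 ≤ |κ'| * (48 * V1 + 1) * R ^ 2 := by nlinarith
    exact le_of_mul_le_mul_right this hR2
  have h6 : |κ'| * (48 * V1 + 1) < 6 * R * V1 := by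
    have : 6 * R * V1 = |κ'| * (48 * V1 + 1) + 6 * V1 := by
      rw [hR]
      field_simp
    rw [this]
    linarith
  linarith

end Targets

end LinearProfiles

end Summit.NavierStokesRegularity.NavierStokesRegularity.Cruxes.MustSqueeze.Disproof
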